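import Mathlib
import HarnessLib

/-!
# Crux `DescentPerfectToAll` (stmt-ResolutionOfSingularities-0549) — lens 5, g9: PORT-READY combinatorial core of the TORIC LEMMA
# (memo `CLASSBC-prank2-toric-lens5-g9.md` §3, case ρ = 2, rank 1): positive unimodular refinement around an irrational ray

SUPPORT workfile (res-B-lens-5 g9, 2026-08-29; rev 9 res-B-lens-5 g10, 2026-08-29).  OURS · counted 0.  Nothing here proves resolution in characteristic `p`; no crux or
stub is proved here.  Pure lattice combinatorics, Mathlib-only, def-free.

THE STATEMENT (`exists_unimodular_positive_refinement`).  Let `ω = (ω₁, ω₂) ∈ ℝ²` with `ω₁, ω₂ > 0` and `ℚ`-independent coordinates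
(`u ω₁ + v ω₂ = 0 ⇒ u = v = 0` for integers `u, v` — the weight ray is irrational), and let `F` be a finite set of integral linear forms
`f = (f₁, f₂)` with `f(ω) > 0`.  Then there is a basis `n₁ = (a, c)`, `n₂ = (b, d)` of `ℤ²` (`ad − bc = ±1`) with non-negative entries such
that `ω = α n₁ + β n₂` with `α, β > 0` (ω in the OPEN cone) and `f(n₁) > 0`, `f(n₂) > 0` for every `f ∈ F`.
In the memo: `N′ ∩ W*` ≅ `ℤ²` is the saturated weight plane of the dual lattice, `ω` the weight vector (`ρ = 2` ⇔ irrational ray), `F` the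
finitely many exponents (of `s₁, s₂, s₃`, of `x, y`, of the graded pieces) with positive value; the refined basis gives the regular cone `τ`
whose first two dual monomials carry positive value and on which all those elements are regular — the (3 − ρ) remaining dual vectors are
chosen in `ker`-directions (value zero) by unimodular completion (not in this file).

SCOPE (rev 3 wording).  `ρ := dim W*`, `W*` = the rational hull of the weight data in `N′_ℚ` (class (B): of the ray `ω = (v(s₁), v(s₂), v(s₃))
∈ ℝ³`; class (C): the span of the two integral level-weights `w¹, w²`), and `ρ ∈ {1, 2}` (`ρ ≤ rr(Γ_M) = 2`; NOTE `ρ = 1` CAN occur in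
class (B) even under (P2) — the parameter values `v(s_i)` may be rationally dependent although `rr Γ = 2`; an earlier claim «(P2) forces
ρ = 2» (bus l.85628) is withdrawn).  `ρ = 1`: the weight ray is RATIONAL — `n₁` := the primitive lattice vector on it, `n₂, n₃` any unimodular
completion; every `f` with positive value has `⟨f, n₁⟩ > 0` automatically; nothing to refine (port-side bookkeeping only).  `ρ = 2`, CLASS (B):
the weight plane `W* ∩ N′ ≅ ℤ²` carries the IRRATIONAL ray `ω` — `exists_unimodular_positive_refinement(')` below; the port supplies (i) a
`ℤ`-basis `(e₁, e₂)` of the saturated plane (coordinates `ω₁, ω₂` of `ω`; `F` ∋ the pairs `(⟨f, e₁⟩, ⟨f, e₂⟩)`), (ii) a unimodular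
completion `n₃` (automatically of value zero), both Smith-normal-form bookkeeping.  `ρ = 2`, CLASS (C) (composite rank two):
the value group has rational rank one per level, so on the plane the weight is LEXICOGRAPHIC `n ↦ (⟨n,w¹⟩, ⟨n,w²⟩)` with `w¹, w²` INTEGRAL and
independent — the first weight ray is RATIONAL and the refinement is elementary (primitive vector + Bezout + shear):
`exists_unimodular_lex_refinement` (rev 2, last section).  Together with the trivial `ρ = 1` case the two theorems are the whole
combinatorial input of §3 (both classes, every `ρ`).  (rev 4) `exists_adapted_basis_rank3` lifts the class-(B) plane theorem to a rank-3
lattice `L` with a basis ADAPTED TO `ker φ` (`φ(e₂) = 0`; producing that adapted basis — `ker φ` saturated of rank one — is the port's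
Smith-normal-form step): a unimodular change in the `(e₀, e₁)`-plane gives `(m₁, m₂, e₂)` with `φ(m₁), φ(m₂) > 0` and every `f ∈ F`
(positive weight) with positive `m₁, m₂`-coordinates = memo §3 (i)–(iv) in primal form.  (rev 5) `exists_adapted_basis_rank3_archimedean`:
the same with `φ : L →+ W` valued in ANY archimedean linearly ordered additive group `W` (the port's `Additive Γˣ`; class (B) = rank one
= archimedean value group, `Valuation.nonempty_rankOne_iff_mulArchimedean`), via Hölder's embedding `W ↪o ℝ`
(Mathlib `Archimedean.exists_orderAddMonoidHom_real_injective`) — no real numbers needed upstream.  (rev 6) THE SMITH-NORMAL-FORM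
STEP and the packaged dichotomy: `exists_kernel_adapted_basis` (kernel of rank one ⇒ a basis with `e 2 ∈ ker φ`, `φ(e 0), φ(e 1)`
independent; Mathlib `Submodule.smithNormalForm` + saturation of the kernel), `exists_kernel_adapted_basis_of_rank_two_ker(_pos)` (the
rational-ray case `ρ = 1`: two kernel basis vectors, the third carries the weight, positive coordinates automatic), and
`toric_lemma_classB` = memo §3 TORIC LEMMA for class (B) in full, lattice form: from ONE integer relation among the weights (`rr Γ ≤ 2`,
i.e. (htd)) and `φ ≠ 0`, either the `ρ = 2` adapted triple or the `ρ = 1` adapted basis, every positive-value `f ∈ F` with non-negative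
(positive where it matters) coordinates.  (rev 7) `toric_lemma_classC` = the same for class (C) (rank-two value group), COMPLETE: the
weight is read through two integer functionals `φ₁` (class in `Γ/Δ`) and `φ₂` (a `Δ`-coordinate), positivity is lexicographic; internally
`Φ = (φ₁, φ₂) : L →+ ℤ ×ₗ ℤ` is a linearly ordered group, so the rev-6 kernel/`ρ = 1` machinery applies verbatim and the `ρ = 2` plane is
`exists_unimodular_lex_refinement`.  What the port still does for §3: build `L` (= Λ′ ≅ ℤ³ via (IND)), `φ` (class (B)) or `φ₁, φ₂`
(class (C): the two-level reading of values) and read the chart `u_i :=` monomial of `m_i` off the output.  (rev 9, g10) KERNEL CLAUSE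
exported in the `ρ = 2` branch of `toric_lemma_classB` (`φ f = 0 → e.repr f 0 = e.repr f 1 = 0`, i.e. `ker φ = ℤ·e 2`) and of
`toric_lemma_classC` (`φ₁ f = φ₂ f = 0 → …`): it was in hand (`exists_kernel_adapted_basis`'s independence output) but dropped from the
rev-6/7 statements, and the T-slice assembly (`Lens5_PRankTwoAssembly.port_toricChart`) needs it to place the value-ZERO graded pieces in
the span of the value-zero chart vectors (memo §13(c): non-negative exponents on the value-positive ones).  In the `ρ = 1` branches the
clause is immediate from the exported `φ f = e.repr f i₀ • φ (e i₀)`, `0 < φ (e i₀)`.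

PROOF (Stern–Brocot / subtractive Euclid on `(α, β)`, no limits): state = basis `(a b c d)` + coordinates `(α, β)` of `ω`; step I
(`β < α`): `n₂ ↦ n₁ + n₂`, `α ↦ α − β`; step II (`α < β`): `n₁ ↦ n₁ + n₂`, `β ↦ β − α` (`α ≠ β` by irrationality).  For `f` with
`λ = (f(n₁), f(n₂)) ∈ ℤ²` one has `α λ₁ + β λ₂ = f(ω) > 0` throughout; the potential `T(λ) = 0` if `λ₁, λ₂ > 0`, else `|λ₁| + |λ₂| + 1`, never
increases (`termI_le`, `termII_le`) and decreases strictly unless `f` is good or in the waiting position `λ₁ = 0` (step I) / `λ₂ = 0`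
(step II) (`termI_lt`, `termII_lt`); a waiting `f` becomes good at the next step of the other type, and consecutive steps of the same type
number at most `⌊α/β⌋ + ⌊β/α⌋`.  Double induction on (Σ_f T, ⌊α/β⌋ + ⌊β/α⌋) (`refine_aux`).
Resolution of singularities in positive characteristic is NOT proved.
-/

noncomputable section

set_option linter.dupNamespace false

namespace Summit.ResolutionOfSingularities.ResolutionOfSingularities.Cruxes.DescentPerfectToAll.CpSibling.UnimodularRefinement

/-! ## Per-functional potential: step I (`λ ↦ (λ₁, λ₁ + λ₂)`, when `β < α`) -/

theorem termI_le (α β : ℝ) (hβ : 0 < β) (hβα : β < α) (x y x' : ℤ) (hx' : x' = x + y)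
    (h : 0 < (x : ℝ) * α + y * β) :
    (if 0 < x ∧ 0 < x' then 0 else x.natAbs + x'.natAbs + 1) ≤
      (if 0 < x ∧ 0 < y then 0 else x.natAbs + y.natAbs + 1) := by
  subst hx'
  by_cases hg : 0 < x ∧ 0 < y
  · have hg' : 0 < x ∧ 0 < x + y := ⟨hg.1, by omega⟩
    rw [if_pos hg', if_pos hg]
  · rw [if_neg hg]
    by_cases hg' : 0 < x ∧ 0 < x + y
    · rw [if_pos hg']; exact Nat.zero_le _
    · rw [if_neg hg']
      rcases le_or_gt x 0 with hx | hx
      · have hxy : 0 < x + y := by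
          by_contra hcon
          have hcon' : ((x : ℝ) + y) ≤ 0 := by exact_mod_cast (not_lt.mp hcon)
          have hx0 : (x : ℝ) ≤ 0 := by exact_mod_cast hx
          nlinarith
        omega
      · omega

theorem termI_lt (α β : ℝ) (hβ : 0 < β) (hβα : β < α) (x y x' : ℤ) (hx' : x' = x + y)
    (h : 0 < (x : ℝ) * α + y * β) (hng : ¬ (0 < x ∧ 0 < y)) (hx0 : x ≠ 0) :
    (if 0 < x ∧ 0 < x' then 0 else x.natAbs + x'.natAbs + 1) <
      (if 0 < x ∧ 0 < y then 0 else x.natAbs + y.natAbs + 1) := by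
  subst hx'
  rw [if_neg hng]
  by_cases hg' : 0 < x ∧ 0 < x + y
  · rw [if_pos hg']; omega
  · rw [if_neg hg']
    rcases le_or_gt x 0 with hx | hx
    · have hxy : 0 < x + y := by
        by_contra hcon
        have hcon' : ((x : ℝ) + y) ≤ 0 := by exact_mod_cast (not_lt.mp hcon)
        have hx0' : (x : ℝ) ≤ 0 := by exact_mod_cast hx
        nlinarith
      omega
    · omega

/-! ## Per-functional potential: step II (`λ ↦ (λ₁ + λ₂, λ₂)`, when `α < β`) -/

theorem termII_le (α β : ℝ) (hα : 0 < α) (hαβ : α < β) (x y y' : ℤ) (hy' : y' = x + y)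
    (h : 0 < (x : ℝ) * α + y * β) :
    (if 0 < y' ∧ 0 < y then 0 else y'.natAbs + y.natAbs + 1) ≤
      (if 0 < x ∧ 0 < y then 0 else x.natAbs + y.natAbs + 1) := by
  subst hy'
  by_cases hg : 0 < x ∧ 0 < y
  · have hg' : 0 < x + y ∧ 0 < y := ⟨by omega, hg.2⟩
    rw [if_pos hg', if_pos hg]
  · rw [if_neg hg]
    by_cases hg' : 0 < x + y ∧ 0 < y
    · rw [if_pos hg']; exact Nat.zero_le _
    · rw [if_neg hg']
      rcases le_or_gt y 0 with hy | hy
      · have hxy : 0 < x + y := by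
          by_contra hcon
          have hcon' : ((x : ℝ) + y) ≤ 0 := by exact_mod_cast (not_lt.mp hcon)
          have hy0 : (y : ℝ) ≤ 0 := by exact_mod_cast hy
          nlinarith
        omega
      · omega

theorem termII_lt (α β : ℝ) (hα : 0 < α) (hαβ : α < β) (x y y' : ℤ) (hy' : y' = x + y)
    (h : 0 < (x : ℝ) * α + y * β) (hng : ¬ (0 < x ∧ 0 < y)) (hy0 : y ≠ 0) :
    (if 0 < y' ∧ 0 < y then 0 else y'.natAbs + y.natAbs + 1) <
      (if 0 < x ∧ 0 < y then 0 else x.natAbs + y.natAbs + 1) := by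
  subst hy'
  rw [if_neg hng]
  by_cases hg' : 0 < x + y ∧ 0 < y
  · rw [if_pos hg']; omega
  · rw [if_neg hg']
    rcases le_or_gt y 0 with hy | hy
    · have hxy : 0 < x + y := by
        by_contra hcon
        have hcon' : ((x : ℝ) + y) ≤ 0 := by exact_mod_cast (not_lt.mp hcon)
        have hy0' : (y : ℝ) ≤ 0 := by exact_mod_cast hy
        nlinarith
      omega
    · omega

/-! ## The invariant forces `α ≠ β` -/

theorem ne_of_state (ω₁ ω₂ : ℝ) (hind : ∀ u v : ℤ, (u : ℝ) * ω₁ + v * ω₂ = 0 → u = 0 ∧ v = 0)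
    (α β : ℝ) (a b c d : ℤ) (ha : 0 ≤ a) (hb : 0 ≤ b) (hc : 0 ≤ c) (hd : 0 ≤ d)
    (hdet : a * d - b * c = 1 ∨ a * d - b * c = -1) (h1 : ω₁ = a * α + b * β) (h2 : ω₂ = c * α + d * β) :
    α ≠ β := by
  intro hαβ
  have e : ((c + d : ℤ) : ℝ) * ω₁ + ((-(a + b) : ℤ) : ℝ) * ω₂ = 0 := by
    rw [h1, h2, hαβ]; push_cast; ring
  obtain ⟨hcd, hab⟩ := hind _ _ e
  have h0 : a = 0 ∧ b = 0 ∧ c = 0 ∧ d = 0 := by omega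
  obtain ⟨rfl, rfl, rfl, rfl⟩ := h0
  simp at hdet

/-! ## The double induction -/

/-- From any state (positive basis `(a,c),(b,d)`, `ω = α(a,c) + β(b,d)`, `α, β > 0`) whose potential is `≤ M` and whose run-length
bound `⌊α/β⌋ + ⌊β/α⌋` is `≤ R`, a good state is reachable. -/
theorem refine_aux (ω₁ ω₂ : ℝ) (hind : ∀ u v : ℤ, (u : ℝ) * ω₁ + v * ω₂ = 0 → u = 0 ∧ v = 0)
    (F : Finset (ℤ × ℤ)) (hF : ∀ f ∈ F, 0 < (f.1 : ℝ) * ω₁ + f.2 * ω₂) :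
    ∀ (M R : ℕ) (α β : ℝ) (a b c d : ℤ), 0 < α → 0 < β → 0 ≤ a → 0 ≤ b → 0 ≤ c → 0 ≤ d →
      (a * d - b * c = 1 ∨ a * d - b * c = -1) → ω₁ = a * α + b * β → ω₂ = c * α + d * β →
      (∑ f ∈ F, (if 0 < f.1 * a + f.2 * c ∧ 0 < f.1 * b + f.2 * d then 0
          else (f.1 * a + f.2 * c).natAbs + (f.1 * b + f.2 * d).natAbs + 1)) ≤ M →
      ⌊α / β⌋₊ + ⌊β / α⌋₊ ≤ R →
      ∃ (a' b' c' d' : ℤ) (α' β' : ℝ), 0 < α' ∧ 0 < β' ∧ 0 ≤ a' ∧ 0 ≤ b' ∧ 0 ≤ c' ∧ 0 ≤ d' ∧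
        (a' * d' - b' * c' = 1 ∨ a' * d' - b' * c' = -1) ∧ ω₁ = a' * α' + b' * β' ∧ ω₂ = c' * α' + d' * β' ∧
        ∀ f ∈ F, 0 < f.1 * a' + f.2 * c' ∧ 0 < f.1 * b' + f.2 * d' := by
  -- the value of `f` is conserved: `λ₁ α + λ₂ β = f(ω)`
  have hval : ∀ (α β : ℝ) (a b c d : ℤ), ω₁ = a * α + b * β → ω₂ = c * α + d * β →
      ∀ f ∈ F, 0 < ((f.1 * a + f.2 * c : ℤ) : ℝ) * α + ((f.1 * b + f.2 * d : ℤ) : ℝ) * β := by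
    intro α β a b c d h1 h2 f hf
    have := hF f hf
    rw [h1, h2] at this
    push_cast
    nlinarith [this]
  intro M
  induction M with
  | zero =>
    intro R α β a b c d hα hβ ha hb hc hd hdet h1 h2 hMes hR
    refine ⟨a, b, c, d, α, β, hα, hβ, ha, hb, hc, hd, hdet, h1, h2, ?_⟩
    intro f hf
    have h0 := (Finset.sum_eq_zero_iff.mp (Nat.le_zero.mp hMes)) f hf
    by_contra hng
    rw [if_neg hng] at h0
    omega
  | succ M ihM =>
    intro R
    induction R with
    | zero =>
      intro α β a b c d hα hβ ha hb hc hd hdet h1 h2 hMes hR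
      exfalso
      have hf1 : ⌊α / β⌋₊ = 0 := by omega
      have hf2 : ⌊β / α⌋₊ = 0 := by omega
      rw [Nat.floor_eq_zero, div_lt_one hβ] at hf1
      rw [Nat.floor_eq_zero, div_lt_one hα] at hf2
      exact lt_asymm hf1 hf2
    | succ R ihR =>
      intro α β a b c d hα hβ ha hb hc hd hdet h1 h2 hMes hR
      by_cases hall : ∀ f ∈ F, 0 < f.1 * a + f.2 * c ∧ 0 < f.1 * b + f.2 * d
      · exact ⟨a, b, c, d, α, β, hα, hβ, ha, hb, hc, hd, hdet, h1, h2, hall⟩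
      have hne : α ≠ β := ne_of_state ω₁ ω₂ hind α β a b c d ha hb hc hd hdet h1 h2
      have hvf := hval α β a b c d h1 h2
      rcases lt_or_gt_of_ne hne with hlt | hgt
      · ------------------------------------------------------------------ step II: (α, β − α, a + b, b, c + d, d)
        have hβ' : 0 < β - α := sub_pos.mpr hlt
        have hdet' : (a + b) * d - b * (c + d) = 1 ∨ (a + b) * d - b * (c + d) = -1 := by
          have e : (a + b) * d - b * (c + d) = a * d - b * c := by ring
          rw [e]; exact hdet
        have h1' : ω₁ = ((a + b : ℤ) : ℝ) * α + b * (β - α) := by rw [h1]; push_cast; ring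
        have h2' : ω₂ = ((c + d : ℤ) : ℝ) * α + d * (β - α) := by rw [h2]; push_cast; ring
        have hle : (∑ f ∈ F, (if 0 < f.1 * (a + b) + f.2 * (c + d) ∧ 0 < f.1 * b + f.2 * d then 0
            else (f.1 * (a + b) + f.2 * (c + d)).natAbs + (f.1 * b + f.2 * d).natAbs + 1)) ≤
            (∑ f ∈ F, (if 0 < f.1 * a + f.2 * c ∧ 0 < f.1 * b + f.2 * d then 0
            else (f.1 * a + f.2 * c).natAbs + (f.1 * b + f.2 * d).natAbs + 1)) :=
          Finset.sum_le_sum fun f hf =>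
            termII_le α β hα hlt _ _ _ (by ring) (hvf f hf)
        rcases hle.lt_or_eq with hlt2 | heq2
        · -- potential dropped: outer induction hypothesis
          exact ihM _ α (β - α) (a + b) b (c + d) d hα hβ' (by omega) hb (by omega) hd hdet' h1' h2'
            (by omega) le_rfl
        · -- potential unchanged: every non-good `f` waits with `λ₂ = 0`
          have hwait : ∀ f ∈ F, ¬ (0 < f.1 * a + f.2 * c ∧ 0 < f.1 * b + f.2 * d) → f.1 * b + f.2 * d = 0 := by
            intro f hf hng
            by_contra hy0
            have hlt3 := Finset.sum_lt_sum
              (fun f hf => termII_le α β hα hlt (f.1 * a + f.2 * c) (f.1 * b + f.2 * d)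
                (f.1 * (a + b) + f.2 * (c + d)) (by ring) (hvf f hf))
              ⟨f, hf, termII_lt α β hα hlt (f.1 * a + f.2 * c) (f.1 * b + f.2 * d)
                (f.1 * (a + b) + f.2 * (c + d)) (by ring) (hvf f hf) hng hy0⟩
            exact absurd heq2 (ne_of_lt hlt3)
          have hne' : α ≠ β - α :=
            ne_of_state ω₁ ω₂ hind α (β - α) (a + b) b (c + d) d (by omega) hb (by omega) hd hdet' h1' h2'
          rcases lt_or_gt_of_ne hne' with hlt4 | hgt4
          · -- next step is again of type II: inner induction hypothesis (run-length bound drops)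
            refine ihR α (β - α) (a + b) b (c + d) d hα hβ' (by omega) hb (by omega) hd hdet' h1' h2'
              (heq2 ▸ hMes) ?_
            have hq1 : ⌊α / (β - α)⌋₊ = 0 := by
              rw [Nat.floor_eq_zero, div_lt_one hβ']; exact hlt4
            have hq2 : ⌊(β - α) / α⌋₊ = ⌊β / α⌋₊ - 1 := by
              rw [sub_div, div_self hα.ne', Nat.floor_sub_one]
            have hq3 : ⌊α / β⌋₊ = 0 := by
              rw [Nat.floor_eq_zero, div_lt_one hβ]; exact hlt
            omega
          · -- next step is of type I: after it every `f` is good: final state (2α − β, β − α, a + b, a + 2b, c + d, c + 2d)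
            have hα'' : 0 < α - (β - α) := sub_pos.mpr hgt4
            refine ⟨a + b, (a + b) + b, c + d, (c + d) + d, α - (β - α), β - α, hα'', hβ', by omega, by omega,
              by omega, by omega, ?_, ?_, ?_, ?_⟩
            · have e : (a + b) * (c + d + d) - (a + b + b) * (c + d) = a * d - b * c := by ring
              rw [e]; exact hdet
            · rw [h1]; push_cast; ring
            · rw [h2]; push_cast; ring
            · intro f hf
              by_cases hg : 0 < f.1 * a + f.2 * c ∧ 0 < f.1 * b + f.2 * d
              · constructor <;> nlinarith [hg.1, hg.2]
              · have hy0 := hwait f hf hg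
                have hx : 0 < f.1 * a + f.2 * c := by
                  have := hvf f hf
                  have hy0' : ((f.1 * b + f.2 * d : ℤ) : ℝ) = 0 := by exact_mod_cast hy0
                  rw [hy0', zero_mul, add_zero] at this
                  have hx' : (0 : ℝ) < ((f.1 * a + f.2 * c : ℤ) : ℝ) := (pos_iff_pos_of_mul_pos this).mpr hα
                  exact_mod_cast hx'
                constructor <;> nlinarith [hx, hy0]
      · ------------------------------------------------------------------ step I: (α − β, β, a, a + b, c, c + d)
        have hα' : 0 < α - β := sub_pos.mpr hgt
        have hdet' : a * (c + d) - (a + b) * c = 1 ∨ a * (c + d) - (a + b) * c = -1 := by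
          have e : a * (c + d) - (a + b) * c = a * d - b * c := by ring
          rw [e]; exact hdet
        have h1' : ω₁ = (a : ℝ) * (α - β) + ((a + b : ℤ) : ℝ) * β := by rw [h1]; push_cast; ring
        have h2' : ω₂ = (c : ℝ) * (α - β) + ((c + d : ℤ) : ℝ) * β := by rw [h2]; push_cast; ring
        have hle : (∑ f ∈ F, (if 0 < f.1 * a + f.2 * c ∧ 0 < f.1 * (a + b) + f.2 * (c + d) then 0
            else (f.1 * a + f.2 * c).natAbs + (f.1 * (a + b) + f.2 * (c + d)).natAbs + 1)) ≤
            (∑ f ∈ F, (if 0 < f.1 * a + f.2 * c ∧ 0 < f.1 * b + f.2 * d then 0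
            else (f.1 * a + f.2 * c).natAbs + (f.1 * b + f.2 * d).natAbs + 1)) :=
          Finset.sum_le_sum fun f hf =>
            termI_le α β hβ hgt _ _ _ (by ring) (hvf f hf)
        rcases hle.lt_or_eq with hlt2 | heq2
        · -- potential dropped: outer induction hypothesis
          exact ihM _ (α - β) β a (a + b) c (c + d) hα' hβ ha (by omega) hc (by omega) hdet' h1' h2'
            (by omega) le_rfl
        · -- potential unchanged: every non-good `f` waits with `λ₁ = 0`
          have hwait : ∀ f ∈ F, ¬ (0 < f.1 * a + f.2 * c ∧ 0 < f.1 * b + f.2 * d) → f.1 * a + f.2 * c = 0 := by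
            intro f hf hng
            by_contra hx0
            have hlt3 := Finset.sum_lt_sum
              (fun f hf => termI_le α β hβ hgt (f.1 * a + f.2 * c) (f.1 * b + f.2 * d)
                (f.1 * (a + b) + f.2 * (c + d)) (by ring) (hvf f hf))
              ⟨f, hf, termI_lt α β hβ hgt (f.1 * a + f.2 * c) (f.1 * b + f.2 * d)
                (f.1 * (a + b) + f.2 * (c + d)) (by ring) (hvf f hf) hng hx0⟩
            exact absurd heq2 (ne_of_lt hlt3)
          have hne' : α - β ≠ β :=
            ne_of_state ω₁ ω₂ hind (α - β) β a (a + b) c (c + d) ha (by omega) hc (by omega) hdet' h1' h2'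
          rcases lt_or_gt_of_ne hne' with hlt4 | hgt4
          · -- next step is of type II: after it every `f` is good: final state (α − β, 2β − α, 2a + b, a + b, 2c + d, c + d)
            have hβ'' : 0 < β - (α - β) := sub_pos.mpr hlt4
            refine ⟨a + (a + b), a + b, c + (c + d), c + d, α - β, β - (α - β), hα', hβ'', by omega, by omega,
              by omega, by omega, ?_, ?_, ?_, ?_⟩
            · have e : (a + (a + b)) * (c + d) - (a + b) * (c + (c + d)) = a * d - b * c := by ring
              rw [e]; exact hdet
            · rw [h1]; push_cast; ring
            · rw [h2]; push_cast; ring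
            · intro f hf
              by_cases hg : 0 < f.1 * a + f.2 * c ∧ 0 < f.1 * b + f.2 * d
              · constructor <;> nlinarith [hg.1, hg.2]
              · have hx0 := hwait f hf hg
                have hy : 0 < f.1 * b + f.2 * d := by
                  have := hvf f hf
                  have hx0' : ((f.1 * a + f.2 * c : ℤ) : ℝ) = 0 := by exact_mod_cast hx0
                  rw [hx0', zero_mul, zero_add] at this
                  have hy' : (0 : ℝ) < ((f.1 * b + f.2 * d : ℤ) : ℝ) := (pos_iff_pos_of_mul_pos this).mpr hβ
                  exact_mod_cast hy'
                constructor <;> nlinarith [hy, hx0]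
          · -- next step is again of type I: inner induction hypothesis (run-length bound drops)
            refine ihR (α - β) β a (a + b) c (c + d) hα' hβ ha (by omega) hc (by omega) hdet' h1' h2'
              (heq2 ▸ hMes) ?_
            have hq1 : ⌊β / (α - β)⌋₊ = 0 := by
              rw [Nat.floor_eq_zero, div_lt_one hα']; exact hgt4
            have hq2 : ⌊(α - β) / β⌋₊ = ⌊α / β⌋₊ - 1 := by
              rw [sub_div, div_self hβ.ne', Nat.floor_sub_one]
            have hq3 : ⌊β / α⌋₊ = 0 := by
              rw [Nat.floor_eq_zero, div_lt_one hα]; exact hgt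
            omega

/-! ## The refinement theorems -/

/-- **Positive unimodular refinement around an irrational ray (positive quadrant).**  `ω = (ω₁, ω₂)`, `ω₁, ω₂ > 0`, `ℚ`-independent;
`F` finite set of integral forms positive at `ω`.  Then `ℤ²` has a basis `(a, c), (b, d)` with non-negative entries, `ad − bc = ±1`,
`ω = α (a, c) + β (b, d)` with `α, β > 0`, and every `f ∈ F` positive on both basis vectors. -/
theorem exists_unimodular_positive_refinement (ω₁ ω₂ : ℝ) (hω₁ : 0 < ω₁) (hω₂ : 0 < ω₂)
    (hind : ∀ u v : ℤ, (u : ℝ) * ω₁ + v * ω₂ = 0 → u = 0 ∧ v = 0)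
    (F : Finset (ℤ × ℤ)) (hF : ∀ f ∈ F, 0 < (f.1 : ℝ) * ω₁ + f.2 * ω₂) :
    ∃ (a b c d : ℤ) (α β : ℝ), 0 < α ∧ 0 < β ∧ 0 ≤ a ∧ 0 ≤ b ∧ 0 ≤ c ∧ 0 ≤ d ∧
      (a * d - b * c = 1 ∨ a * d - b * c = -1) ∧ ω₁ = a * α + b * β ∧ ω₂ = c * α + d * β ∧
      ∀ f ∈ F, 0 < f.1 * a + f.2 * c ∧ 0 < f.1 * b + f.2 * d :=
  refine_aux ω₁ ω₂ hind F hF _ _ ω₁ ω₂ 1 0 0 1 hω₁ hω₂ (by norm_num) le_rfl le_rfl (by norm_num) (by norm_num)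
    (by push_cast; ring) (by push_cast; ring) le_rfl le_rfl

/-- **Positive unimodular refinement around an irrational ray (any quadrant).**  Same, for `ω` with `ℚ`-independent coordinates of any
signs (the basis vectors then have entries of the corresponding signs; only `det = ±1` is recorded). -/
theorem exists_unimodular_positive_refinement' (ω₁ ω₂ : ℝ)
    (hind : ∀ u v : ℤ, (u : ℝ) * ω₁ + v * ω₂ = 0 → u = 0 ∧ v = 0)
    (F : Finset (ℤ × ℤ)) (hF : ∀ f ∈ F, 0 < (f.1 : ℝ) * ω₁ + f.2 * ω₂) :
    ∃ (a b c d : ℤ) (α β : ℝ), 0 < α ∧ 0 < β ∧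
      (a * d - b * c = 1 ∨ a * d - b * c = -1) ∧ ω₁ = a * α + b * β ∧ ω₂ = c * α + d * β ∧
      ∀ f ∈ F, 0 < f.1 * a + f.2 * c ∧ 0 < f.1 * b + f.2 * d := by
  classical
  -- signs
  have hω₁ : ω₁ ≠ 0 := by
    intro h; have := (hind 1 0 (by rw [h]; simp)).1; exact one_ne_zero this
  have hω₂ : ω₂ ≠ 0 := by
    intro h; have := (hind 0 1 (by rw [h]; simp)).2; exact one_ne_zero this
  obtain ⟨s₁, hs₁, hs₁ω⟩ : ∃ s₁ : ℤ, s₁ * s₁ = 1 ∧ 0 < (s₁ : ℝ) * ω₁ := by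
    rcases lt_or_gt_of_ne hω₁ with h | h
    · exact ⟨-1, by norm_num, by push_cast; nlinarith⟩
    · exact ⟨1, by norm_num, by push_cast; nlinarith⟩
  obtain ⟨s₂, hs₂, hs₂ω⟩ : ∃ s₂ : ℤ, s₂ * s₂ = 1 ∧ 0 < (s₂ : ℝ) * ω₂ := by
    rcases lt_or_gt_of_ne hω₂ with h | h
    · exact ⟨-1, by norm_num, by push_cast; nlinarith⟩
    · exact ⟨1, by norm_num, by push_cast; nlinarith⟩
  have hs₁r : (s₁ : ℝ) * s₁ = 1 := by exact_mod_cast hs₁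
  have hs₂r : (s₂ : ℝ) * s₂ = 1 := by exact_mod_cast hs₂
  -- twisted data
  have hind' : ∀ u v : ℤ, (u : ℝ) * (s₁ * ω₁) + v * (s₂ * ω₂) = 0 → u = 0 ∧ v = 0 := by
    intro u v h
    have h' : ((u * s₁ : ℤ) : ℝ) * ω₁ + ((v * s₂ : ℤ) : ℝ) * ω₂ = 0 := by push_cast; linarith [h]
    obtain ⟨h1, h2⟩ := hind _ _ h'
    constructor
    · have := congrArg (· * s₁) h1; simp only [mul_assoc, hs₁, mul_one, zero_mul] at this; exact this
    · have := congrArg (· * s₂) h2; simp only [mul_assoc, hs₂, mul_one, zero_mul] at this; exact this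
  let g : ℤ × ℤ → ℤ × ℤ := fun f => (f.1 * s₁, f.2 * s₂)
  have hF' : ∀ f' ∈ F.image g, 0 < (f'.1 : ℝ) * (s₁ * ω₁) + f'.2 * (s₂ * ω₂) := by
    intro f' hf'
    obtain ⟨f, hf, rfl⟩ := Finset.mem_image.mp hf'
    have := hF f hf
    simp only [g]; push_cast
    have e1 : (f.1 : ℝ) * s₁ * (s₁ * ω₁) = f.1 * ω₁ := by
      rw [mul_assoc, ← mul_assoc (s₁ : ℝ), hs₁r, one_mul]
    have e2 : (f.2 : ℝ) * s₂ * (s₂ * ω₂) = f.2 * ω₂ := by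
      rw [mul_assoc, ← mul_assoc (s₂ : ℝ), hs₂r, one_mul]
    rw [e1, e2]; exact this
  obtain ⟨a, b, c, d, α, β, hα, hβ, -, -, -, -, hdet, h1, h2, hgood⟩ :=
    exists_unimodular_positive_refinement (s₁ * ω₁) (s₂ * ω₂) hs₁ω hs₂ω hind' (F.image g) hF'
  refine ⟨s₁ * a, s₁ * b, s₂ * c, s₂ * d, α, β, hα, hβ, ?_, ?_, ?_, ?_⟩
  · have e : s₁ * a * (s₂ * d) - s₁ * b * (s₂ * c) = (s₁ * s₂) * (a * d - b * c) := by ring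
    have h1' : s₁ = 1 ∨ s₁ = -1 := Int.eq_one_or_neg_one_of_mul_eq_one hs₁
    have h2' : s₂ = 1 ∨ s₂ = -1 := Int.eq_one_or_neg_one_of_mul_eq_one hs₂
    rw [e]
    rcases h1' with rfl | rfl <;> rcases h2' with rfl | rfl <;> rcases hdet with h | h <;> simp [h]
  · calc ω₁ = (s₁ : ℝ) * (s₁ * ω₁) := by rw [← mul_assoc, hs₁r, one_mul]
      _ = _ := by rw [h1]; push_cast; ring
  · calc ω₂ = (s₂ : ℝ) * (s₂ * ω₂) := by rw [← mul_assoc, hs₂r, one_mul]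
      _ = _ := by rw [h2]; push_cast; ring
  · intro f hf
    have := hgood (g f) (Finset.mem_image_of_mem g hf)
    simp only [g] at this
    constructor <;> nlinarith [this.1, this.2]

/-! ## The lexicographic variant (CLASS (C): composite rank two) — a RATIONAL first weight: primitive vector + Bezout + shear

For a composite rank-two valuation the value group has rational rank two, one per level, so the weight map on the plane `W* ∩ N′ ≅ ℤ²`
is `n ↦ (⟨n, w¹⟩, ⟨n, w²⟩)` LEXICOGRAPHICALLY with `w¹, w² ∈ ℤ²` independent (`w¹` = coarse weights, a RATIONAL ray).  The required cone is
then elementary: `n₁` := the primitive vector on the ray of `w¹`, `n₂` := a Bezout complement with `w²`-coordinate `b₂ > 0`, sheared along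
`n₁` until every `f ∈ F` is non-negative on it.  Conclusion: `w¹ = g·n₁` (`g > 0`), `w² = b₁ n₁ + b₂ n₂` (`b₂ > 0`) — so the dual monomials
have lex-values `(g, b₁) > 0` and `(0, b₂) > 0` — and `⟨f, n₁⟩, ⟨f, n₂⟩ ≥ 0` for every `f` of lex-positive value. -/

/-- **Unimodular refinement, lexicographic weights (class (C)).** -/
theorem exists_unimodular_lex_refinement (p₁ p₂ q₁ q₂ : ℤ) (hdet : p₁ * q₂ - p₂ * q₁ ≠ 0)
    (F : Finset (ℤ × ℤ))
    (hF : ∀ f ∈ F, 0 < f.1 * p₁ + f.2 * p₂ ∨ (f.1 * p₁ + f.2 * p₂ = 0 ∧ 0 < f.1 * q₁ + f.2 * q₂)) :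
    ∃ (a b c d g b₁ b₂ : ℤ), (a * d - b * c = 1 ∨ a * d - b * c = -1) ∧ 0 < g ∧ 0 < b₂ ∧
      p₁ = g * a ∧ p₂ = g * c ∧ q₁ = b₁ * a + b₂ * b ∧ q₂ = b₁ * c + b₂ * d ∧
      ∀ f ∈ F, 0 ≤ f.1 * a + f.2 * c ∧ 0 ≤ f.1 * b + f.2 * d := by
  -- the primitive vector `(a, c)` on the ray of `w¹ = (p₁, p₂)`
  have hp : p₁ ≠ 0 ∨ p₂ ≠ 0 := by
    by_contra h
    push Not at h
    obtain ⟨rfl, rfl⟩ := h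
    exact hdet (by ring)
  have hg : 0 < Int.gcd p₁ p₂ := Int.gcd_pos_iff.mpr hp
  set g : ℤ := (Int.gcd p₁ p₂ : ℤ) with hgdef
  have hg' : (0 : ℤ) < g := by rw [hgdef]; exact_mod_cast hg
  set a : ℤ := p₁ / g with hadef
  set c : ℤ := p₂ / g with hcdef
  have hpa : p₁ = g * a := (Int.mul_ediv_cancel' (Int.gcd_dvd_left p₁ p₂)).symm
  have hpc : p₂ = g * c := (Int.mul_ediv_cancel' (Int.gcd_dvd_right p₁ p₂)).symm
  have hac : Int.gcd a c = 1 := Int.gcd_div_gcd_div_gcd hg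
  -- Bezout complement `(b₀, d₀)` with `a d₀ − b₀ c = 1`
  obtain ⟨x, y, hxy⟩ : ∃ x y : ℤ, a * x + c * y = 1 := by
    refine ⟨Int.gcdA a c, Int.gcdB a c, ?_⟩
    have := Int.gcd_eq_gcd_ab a c
    rw [hac] at this
    exact_mod_cast this.symm
  set b₀ : ℤ := -y with hb₀
  set d₀ : ℤ := x with hd₀
  have hdet₀ : a * d₀ - b₀ * c = 1 := by rw [hb₀, hd₀]; linarith [hxy]
  -- coordinates of `w² = (q₁, q₂)` in the basis `(a,c), (b₀,d₀)`
  set β₁ : ℤ := q₁ * d₀ - q₂ * b₀ with hβ₁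
  set β₂ : ℤ := a * q₂ - c * q₁ with hβ₂
  have hq₁ : q₁ = β₁ * a + β₂ * b₀ := by
    have : q₁ * (a * d₀ - b₀ * c) = β₁ * a + β₂ * b₀ := by rw [hβ₁, hβ₂]; ring
    rw [hdet₀, mul_one] at this; exact this
  have hq₂ : q₂ = β₁ * c + β₂ * d₀ := by
    have : q₂ * (a * d₀ - b₀ * c) = β₁ * c + β₂ * d₀ := by rw [hβ₁, hβ₂]; ring
    rw [hdet₀, mul_one] at this; exact this
  have hβ₂0 : β₂ ≠ 0 := by
    intro h0
    apply hdet
    rw [hpa, hpc]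
    have : g * a * q₂ - g * c * q₁ = g * β₂ := by rw [hβ₂]; ring
    rw [this, h0, mul_zero]
  -- sign fix: `s = ±1` with `s β₂ > 0`
  obtain ⟨s, hs, hsβ⟩ : ∃ s : ℤ, (s = 1 ∨ s = -1) ∧ 0 < s * β₂ := by
    rcases lt_or_gt_of_ne hβ₂0 with h | h
    · exact ⟨-1, Or.inr rfl, by linarith⟩
    · exact ⟨1, Or.inl rfl, by linarith⟩
  have hss : s * s = 1 := by rcases hs with rfl | rfl <;> norm_num
  -- shear amount
  set t : ℤ := ∑ f ∈ F, |f.1 * (s * b₀) + f.2 * (s * d₀)| with ht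
  have ht0 : ∀ f ∈ F, |f.1 * (s * b₀) + f.2 * (s * d₀)| ≤ t := fun f hf =>
    Finset.single_le_sum (f := fun f : ℤ × ℤ => |f.1 * (s * b₀) + f.2 * (s * d₀)|) (fun _ _ => abs_nonneg _) hf
  -- the basis: n₁ = (a, c), n₂ = s (b₀, d₀) + t (a, c)
  refine ⟨a, s * b₀ + t * a, c, s * d₀ + t * c, g, β₁ - t * s * β₂, s * β₂, ?_, hg', hsβ, hpa, hpc, ?_, ?_, ?_⟩
  · have e : a * (s * d₀ + t * c) - (s * b₀ + t * a) * c = s * (a * d₀ - b₀ * c) := by ring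
    rw [e, hdet₀, mul_one]; exact hs
  · rw [hq₁]
    have : β₂ * b₀ = s * s * β₂ * b₀ := by rw [hss, one_mul]
    rw [this]; ring
  · rw [hq₂]
    have : β₂ * d₀ = s * s * β₂ * d₀ := by rw [hss, one_mul]
    rw [this]; ring
  · intro f hf
    have hfn₁ : g * (f.1 * a + f.2 * c) = f.1 * p₁ + f.2 * p₂ := by rw [hpa, hpc]; ring
    rcases hF f hf with hpos | ⟨hzero, hpos2⟩
    · -- `f(w¹) > 0`: `f(n₁) ≥ 1` and the shear dominates
      have h1 : 0 < f.1 * a + f.2 * c := by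
        rw [← hfn₁] at hpos
        exact (pos_iff_pos_of_mul_pos hpos).mp hg'
      refine ⟨h1.le, ?_⟩
      have e : f.1 * (s * b₀ + t * a) + f.2 * (s * d₀ + t * c) =
          (f.1 * (s * b₀) + f.2 * (s * d₀)) + t * (f.1 * a + f.2 * c) := by ring
      rw [e]
      have h2 := ht0 f hf
      have h3 : -(f.1 * (s * b₀) + f.2 * (s * d₀)) ≤ t := le_trans (neg_le_abs _) h2
      have h4 : t ≤ t * (f.1 * a + f.2 * c) := by
        have htnn : 0 ≤ t := le_trans (abs_nonneg _) h2
        nlinarith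
      linarith
    · -- `f(w¹) = 0 < f(w²)`: `f(n₁) = 0` and `b₂ f(n₂) = f(w²) > 0`
      have h1 : f.1 * a + f.2 * c = 0 := by
        rw [← hfn₁] at hzero
        rcases mul_eq_zero.mp hzero with h | h
        · exact absurd h hg'.ne'
        · exact h
      refine ⟨h1.symm.le, ?_⟩
      have e : f.1 * (s * b₀ + t * a) + f.2 * (s * d₀ + t * c) = s * (f.1 * b₀ + f.2 * d₀) + t * (f.1 * a + f.2 * c) := by ring
      rw [e, h1, mul_zero, add_zero]
      have hw2 : f.1 * q₁ + f.2 * q₂ = β₁ * (f.1 * a + f.2 * c) + β₂ * (f.1 * b₀ + f.2 * d₀) := by rw [hq₁, hq₂]; ring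
      rw [hw2, h1, mul_zero, zero_add] at hpos2
      -- `0 < β₂ * X` and `0 < s β₂` ⇒ `0 < s * X`... via `(s β₂) (s X) = β₂ X (s² = 1)`
      have : 0 < (s * β₂) * (s * (f.1 * b₀ + f.2 * d₀)) := by
        have e2 : (s * β₂) * (s * (f.1 * b₀ + f.2 * d₀)) = (s * s) * (β₂ * (f.1 * b₀ + f.2 * d₀)) := by ring
        rw [e2, hss, one_mul]; exact hpos2
      exact le_of_lt ((pos_iff_pos_of_mul_pos this).mp hsβ)

/-! ## (rev 4) The toric lemma in a rank-3 lattice, class (B), `ρ = 2` — change of basis adapted to the kernel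

Given a `ℤ`-basis `(e₀, e₁, e₂)` of a lattice `L` ADAPTED TO THE KERNEL of the (real) weight `φ` — `φ(e₂) = 0`, `φ(e₀), φ(e₁)` rationally
independent (this adapted basis is the Smith-normal-form bookkeeping left to the port: `ker φ` is saturated of rank one) — and a finite
`F ⊂ L` of positive weight, there is a new basis `(m₁, m₂, e₂)` (unimodular change in the `(e₀, e₁)`-plane) with `φ(m₁), φ(m₂) > 0` and every
`f ∈ F` having POSITIVE `m₁`- and `m₂`-coordinates: the dual monomials `u₁, u₂` have positive value, `u₃` value zero, and every piece
`g_{j,ab}` is a monomial in `u₁, u₂, u₃^{±1}` — memo §3 (i)–(iv) in primal form ((iii) is then automatic from (ii)). -/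

/-- **TORIC LEMMA, class (B), `ρ = 2`, lattice form.** -/
theorem exists_adapted_basis_rank3 {L : Type} [AddCommGroup L] (e : Module.Basis (Fin 3) ℤ L) (φ : L →+ ℝ)
    (hker : φ (e 2) = 0) (hind : ∀ u v : ℤ, (u : ℝ) * φ (e 0) + v * φ (e 1) = 0 → u = 0 ∧ v = 0)
    (F : Finset L) (hF : ∀ f ∈ F, 0 < φ f) :
    ∃ (m₁ m₂ : L) (a b c d : ℤ), (a * d - b * c = 1 ∨ a * d - b * c = -1) ∧
      e 0 = a • m₁ + b • m₂ ∧ e 1 = c • m₁ + d • m₂ ∧ 0 < φ m₁ ∧ 0 < φ m₂ ∧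
      ∀ f ∈ F, f = (e.repr f 0 * a + e.repr f 1 * c) • m₁ + (e.repr f 0 * b + e.repr f 1 * d) • m₂ + e.repr f 2 • e 2 ∧
        0 < e.repr f 0 * a + e.repr f 1 * c ∧ 0 < e.repr f 0 * b + e.repr f 1 * d := by
  classical
  -- every `f` in coordinates
  have hrepr : ∀ f : L, f = e.repr f 0 • e 0 + e.repr f 1 • e 1 + e.repr f 2 • e 2 := by
    intro f
    conv_lhs => rw [← e.sum_repr f]
    rw [Fin.sum_univ_three]
  have hφ : ∀ f : L, φ f = (e.repr f 0 : ℝ) * φ (e 0) + (e.repr f 1 : ℝ) * φ (e 1) := by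
    intro f
    conv_lhs => rw [hrepr f]
    rw [map_add, map_add, map_zsmul, map_zsmul, map_zsmul, hker, smul_zero, add_zero, zsmul_eq_mul, zsmul_eq_mul]
  -- the plane problem
  obtain ⟨a, b, c, d, α, β, hα, hβ, hdet, h0, h1, hpos⟩ :=
    exists_unimodular_positive_refinement' (φ (e 0)) (φ (e 1)) hind (F.image fun f => (e.repr f 0, e.repr f 1))
      (by
        intro g hg
        obtain ⟨f, hf, rfl⟩ := Finset.mem_image.mp hg
        simpa [hφ f] using hF f hf)
  -- the new basis vectors (inverse of the unimodular matrix, sign-corrected)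
  obtain ⟨ε, hε, hεdet⟩ : ∃ ε : ℤ, (ε = 1 ∨ ε = -1) ∧ ε * (a * d - b * c) = 1 := by
    rcases hdet with h | h
    · exact ⟨1, Or.inl rfl, by rw [h]; ring⟩
    · exact ⟨-1, Or.inr rfl, by rw [h]; ring⟩
  refine ⟨ε • (d • e 0 - b • e 1), ε • (-c • e 0 + a • e 1), a, b, c, d, hdet, ?_, ?_, ?_, ?_, ?_⟩
  · -- `e 0 = a m₁ + b m₂`
    have : a • (ε • (d • e 0 - b • e 1)) + b • (ε • (-c • e 0 + a • e 1)) = (ε * (a * d - b * c)) • e 0 := by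
      module
    rw [this, hεdet, one_smul]
  · have : c • (ε • (d • e 0 - b • e 1)) + d • (ε • (-c • e 0 + a • e 1)) = (ε * (a * d - b * c)) • e 1 := by
      module
    rw [this, hεdet, one_smul]
  · -- `φ m₁ = α`
    have : φ (ε • (d • e 0 - b • e 1)) = (ε * (a * d - b * c) : ℤ) * α := by
      rw [map_zsmul, map_sub, map_zsmul, map_zsmul, h0, h1]
      simp only [zsmul_eq_mul, Int.cast_mul, Int.cast_sub]
      ring
    rw [this, hεdet]; simpa using hα
  · have : φ (ε • (-c • e 0 + a • e 1)) = (ε * (a * d - b * c) : ℤ) * β := by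
      rw [map_zsmul, map_add, map_zsmul, map_zsmul, h0, h1]
      simp only [zsmul_eq_mul, Int.cast_mul, Int.cast_sub, Int.cast_neg]
      ring
    rw [this, hεdet]; simpa using hβ
  · intro f hf
    have hg := hpos (e.repr f 0, e.repr f 1) (Finset.mem_image.mpr ⟨f, hf, rfl⟩)
    refine ⟨?_, hg.1, hg.2⟩
    have key : (e.repr f 0 * a + e.repr f 1 * c) • (ε • (d • e 0 - b • e 1)) +
        (e.repr f 0 * b + e.repr f 1 * d) • (ε • (-c • e 0 + a • e 1)) =
        (ε * (a * d - b * c) * e.repr f 0) • e 0 + (ε * (a * d - b * c) * e.repr f 1) • e 1 := by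
      module
    rw [key, hεdet, one_mul, one_mul]
    exact hrepr f

/-! ## (rev 5) Class (B) with values in any ARCHIMEDEAN ordered group (the port's value group, no `ℝ` needed upstream)

Class (B) means the valuation has rank one, i.e. its value group is archimedean (`Valuation.nonempty_rankOne_iff_mulArchimedean`); the
weight `φ` of §3 then takes values in an archimedean linearly ordered additive group `W` (e.g. `Additive Γˣ`), which embeds into `ℝ` by an
injective ordered homomorphism (Hölder; Mathlib `Archimedean.exists_orderAddMonoidHom_real_injective`).  So the lattice toric lemma holds
verbatim with `φ : L →+ W`. -/

/-- **TORIC LEMMA, class (B), `ρ = 2`, lattice form, archimedean values.** -/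
theorem exists_adapted_basis_rank3_archimedean {L : Type} [AddCommGroup L] {W : Type} [AddCommGroup W] [LinearOrder W]
    [IsOrderedAddMonoid W] [Archimedean W] (e : Module.Basis (Fin 3) ℤ L) (φ : L →+ W)
    (hker : φ (e 2) = 0) (hind : ∀ u v : ℤ, u • φ (e 0) + v • φ (e 1) = 0 → u = 0 ∧ v = 0)
    (F : Finset L) (hF : ∀ f ∈ F, 0 < φ f) :
    ∃ (m₁ m₂ : L) (a b c d : ℤ), (a * d - b * c = 1 ∨ a * d - b * c = -1) ∧
      e 0 = a • m₁ + b • m₂ ∧ e 1 = c • m₁ + d • m₂ ∧ 0 < φ m₁ ∧ 0 < φ m₂ ∧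
      ∀ f ∈ F, f = (e.repr f 0 * a + e.repr f 1 * c) • m₁ + (e.repr f 0 * b + e.repr f 1 * d) • m₂ + e.repr f 2 • e 2 ∧
        0 < e.repr f 0 * a + e.repr f 1 * c ∧ 0 < e.repr f 0 * b + e.repr f 1 * d := by
  obtain ⟨ι, hι⟩ := Archimedean.exists_orderAddMonoidHom_real_injective W
  have hι0 : ∀ w : W, ι w = 0 ↔ w = 0 := fun w => by
    constructor
    · intro h; exact hι (by rw [h, map_zero])
    · intro h; rw [h, map_zero]
  have hιpos : ∀ w : W, 0 < ι w ↔ 0 < w := fun w => by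
    constructor
    · intro h
      by_contra hle
      have hmono : ι w ≤ ι 0 := OrderHomClass.mono ι (not_lt.mp hle)
      rw [map_zero] at hmono
      exact absurd h (not_lt.mpr hmono)
    · intro h
      have hmono : ι 0 ≤ ι w := OrderHomClass.mono ι h.le
      rw [map_zero] at hmono
      rcases hmono.lt_or_eq with hlt | heq
      · exact hlt
      · exact absurd ((hι0 w).mp heq.symm) h.ne'
  let ψ : L →+ ℝ := (ι : W →+ ℝ).comp φ
  have hψ : ∀ x : L, ψ x = ι (φ x) := fun x => rfl
  have hkerψ : ψ (e 2) = 0 := by rw [hψ, hker, map_zero]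
  have hindψ : ∀ u v : ℤ, (u : ℝ) * ψ (e 0) + v * ψ (e 1) = 0 → u = 0 ∧ v = 0 := by
    intro u v huv
    apply hind u v
    rw [← hι0]
    rw [map_add, map_zsmul, map_zsmul, zsmul_eq_mul, zsmul_eq_mul]
    simpa [hψ] using huv
  have hFψ : ∀ f ∈ F, 0 < ψ f := fun f hf => by rw [hψ, hιpos]; exact hF f hf
  obtain ⟨m₁, m₂, a, b, c, d, hdet, h0, h1, hm₁, hm₂, hcoord⟩ := exists_adapted_basis_rank3 e ψ hkerψ hindψ F hFψ
  refine ⟨m₁, m₂, a, b, c, d, hdet, h0, h1, ?_, ?_, hcoord⟩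
  · rw [hψ, hιpos] at hm₁; exact hm₁
  · rw [hψ, hιpos] at hm₂; exact hm₂

/-! ## (rev 6) The Smith-normal-form step: a basis ADAPTED TO THE KERNEL exists (class (B), `ρ = 2`)

For a rank-3 lattice `L` and an additive `φ : L → W` (`W` torsion-free, e.g. any linearly ordered additive group) whose kernel has rank exactly one
— some non-zero `x` with `φ x = 0`, and any two kernel elements dependent — there is a `ℤ`-basis `(e₀, e₁, e₂)` of `L` with `φ(e₂) = 0` and
`φ(e₀), φ(e₁)` independent; this is the input of `exists_adapted_basis_rank3(_archimedean)`.  Proof: Smith normal form of `ker φ ≤ L`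
(Mathlib `Submodule.smithNormalForm`): `bN i = a_i • bM (f i)`, `a_i ≠ 0`, hence `bM (f i) ∈ ker φ` (`W` torsion-free — the kernel is
saturated); exactly one `i` (two would be independent kernel vectors, none would make the kernel zero); re-index so that it sits at `2`. -/

theorem exists_kernel_adapted_basis {L : Type} [AddCommGroup L] (b : Module.Basis (Fin 3) ℤ L) {W : Type} [AddCommGroup W]
    [NoZeroSMulDivisors ℤ W] (φ : L →+ W) (h1 : ∃ x : L, x ≠ 0 ∧ φ x = 0)
    (h2 : ∀ x y : L, φ x = 0 → φ y = 0 → ∃ s t : ℤ, (s ≠ 0 ∨ t ≠ 0) ∧ s • x + t • y = 0) :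
    ∃ e : Module.Basis (Fin 3) ℤ L, φ (e 2) = 0 ∧ ∀ u v : ℤ, u • φ (e 0) + v • φ (e 1) = 0 → u = 0 ∧ v = 0 := by
  classical
  let N : Submodule ℤ L := LinearMap.ker φ.toIntLinearMap
  have hN : ∀ x : L, x ∈ N ↔ φ x = 0 := fun x => by
    simp only [N, LinearMap.mem_ker, AddMonoidHom.coe_toIntLinearMap]
  obtain ⟨n, snf⟩ := Submodule.smithNormalForm b N
  -- the kernel is saturated: each `bM (f i)` lies in it
  have hfi : ∀ i : Fin n, φ (snf.bM (snf.f i)) = 0 := by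
    intro i
    have hmem : ((snf.bN i : N) : L) ∈ N := (snf.bN i).2
    rw [hN, snf.snf i, map_zsmul] at hmem
    have hai : snf.a i ≠ 0 := by
      intro h0
      have h0' : ((snf.bN i : N) : L) = 0 := by rw [snf.snf i, h0, zero_smul]
      exact snf.bN.ne_zero i (Subtype.ext h0')
    exact (smul_eq_zero.mp hmem).resolve_left hai
  -- two distinct `f i`, `f j` would be independent kernel vectors
  have hn2 : ∀ i j : Fin n, i = j := by
    intro i j
    by_contra hij
    obtain ⟨s, t, hst, hrel⟩ := h2 _ _ (hfi i) (hfi j)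
    have hfij : snf.f i ≠ snf.f j := fun h => hij (snf.f.injective h)
    have hci := congrArg (fun x => snf.bM.repr x (snf.f i)) hrel
    have hcj := congrArg (fun x => snf.bM.repr x (snf.f j)) hrel
    simp only [map_add, map_zsmul, Module.Basis.repr_self, Finsupp.coe_add, Finsupp.coe_smul, Pi.add_apply,
      Pi.smul_apply, Finsupp.single_apply, map_zero, Finsupp.coe_zero, Pi.zero_apply] at hci hcj
    simp [hfij, hfij.symm] at hci hcj
    rcases hst with hs | ht
    · exact hs hci
    · exact ht hcj
  -- and `n = 0` would make the kernel trivial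
  have hn0 : n ≠ 0 := by
    intro hn
    subst hn
    obtain ⟨x, hx0, hx⟩ := h1
    have hxN : x ∈ N := (hN x).mpr hx
    have hsum := snf.bN.sum_repr ⟨x, hxN⟩
    rw [Finset.univ_eq_empty, Finset.sum_empty] at hsum
    exact hx0 (by simpa using congrArg Subtype.val hsum.symm)
  -- so `n = 1`
  obtain ⟨i₀⟩ : Nonempty (Fin n) := Fin.pos_iff_nonempty.mp (Nat.pos_of_ne_zero hn0)
  -- re-index: the kernel vector goes to position `2`
  let σ : Fin 3 ≃ Fin 3 := Equiv.swap (snf.f i₀) 2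
  refine ⟨snf.bM.reindex σ, ?_, ?_⟩
  · rw [Module.Basis.reindex_apply]
    have : σ.symm 2 = snf.f i₀ := by
      rw [Equiv.symm_apply_eq]
      exact (Equiv.swap_apply_left _ _).symm
    rw [this]
    exact hfi i₀
  · intro u v huv
    -- `y := u e₀ + v e₁ ∈ ker φ = ℤ bN i₀ = ℤ a • bM (f i₀)`
    have hy : φ (u • snf.bM.reindex σ 0 + v • snf.bM.reindex σ 1) = 0 := by
      rw [map_add, map_zsmul, map_zsmul, huv]
    have hyN : u • snf.bM.reindex σ 0 + v • snf.bM.reindex σ 1 ∈ N := (hN _).mpr hy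
    have hsum := snf.bN.sum_repr ⟨_, hyN⟩
    have huniv : (Finset.univ : Finset (Fin n)) = {i₀} := by
      ext j; simp [hn2 j i₀]
    rw [huniv, Finset.sum_singleton] at hsum
    have hval := congrArg Subtype.val hsum
    simp only [Submodule.coe_smul_of_tower] at hval
    rw [snf.snf i₀] at hval
    -- compare coordinates at `0` and `1` in the basis `bM.reindex σ`
    have hσ0 : σ.symm 0 ≠ snf.f i₀ := by
      rw [Ne, Equiv.symm_apply_eq]
      intro h
      have := Equiv.swap_apply_left (snf.f i₀) (2 : Fin 3)
      rw [this] at h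
      exact absurd h (by decide)
    have hσ1 : σ.symm 1 ≠ snf.f i₀ := by
      rw [Ne, Equiv.symm_apply_eq]
      intro h
      have := Equiv.swap_apply_left (snf.f i₀) (2 : Fin 3)
      rw [this] at h
      exact absurd h (by decide)
    have hc0 := congrArg (fun x => (snf.bM.reindex σ).repr x 0) hval
    have hc1 := congrArg (fun x => (snf.bM.reindex σ).repr x 1) hval
    simp only [map_add, map_zsmul, Module.Basis.repr_self, Finsupp.coe_add, Finsupp.coe_smul, Pi.add_apply,
      Pi.smul_apply, Finsupp.single_apply, Module.Basis.repr_reindex_apply, smul_eq_mul] at hc0 hc1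
    simp [Ne.symm hσ0, Ne.symm hσ1] at hc0 hc1
    exact ⟨hc0.symm, hc1.symm⟩

/-! ## (rev 6) The rational-ray case `ρ = 1` (kernel of rank two): adapted basis, and §3 (i)–(iv) are automatic

If `ker φ` has rank two (two independent kernel vectors; `φ ≠ 0`), Smith normal form gives a basis with two kernel vectors; the third vector
`e_{i₀}` carries all the weight: `φ f = (e.repr f i₀) • φ(e_{i₀})`, so after a sign every `f` of positive weight has a positive
`i₀`-coordinate — the toric chart is `u_{i₀}` (value `> 0`), `u_i` (`i ≠ i₀`, value `0`, units `u_i^{±1}`), no refinement needed. -/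

lemma fin3_third (i i₀ : Fin 3) (h : i ≠ i₀) : ∃ k : Fin 3, k ≠ i ∧ k ≠ i₀ := by
  revert i i₀; decide

lemma fin3_cases (i i₀ k : Fin 3) (hi : i ≠ i₀) (hk : k ≠ i) (hk₀ : k ≠ i₀) : ∀ j : Fin 3, j = i ∨ j = i₀ ∨ j = k := by
  revert i i₀ k; decide

theorem exists_kernel_adapted_basis_of_rank_two_ker {L : Type} [AddCommGroup L] (b : Module.Basis (Fin 3) ℤ L) {W : Type}
    [AddCommGroup W] [NoZeroSMulDivisors ℤ W] (φ : L →+ W) (h0 : ∃ x : L, φ x ≠ 0)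
    (h2 : ∃ x y : L, φ x = 0 ∧ φ y = 0 ∧ ∀ s t : ℤ, s • x + t • y = 0 → s = 0 ∧ t = 0) :
    ∃ (e : Module.Basis (Fin 3) ℤ L) (i₀ : Fin 3), φ (e i₀) ≠ 0 ∧ (∀ i, i ≠ i₀ → φ (e i) = 0) ∧
      ∀ f : L, φ f = e.repr f i₀ • φ (e i₀) := by
  classical
  let N : Submodule ℤ L := LinearMap.ker φ.toIntLinearMap
  have hN : ∀ x : L, x ∈ N ↔ φ x = 0 := fun x => by
    simp only [N, LinearMap.mem_ker, AddMonoidHom.coe_toIntLinearMap]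
  obtain ⟨n, snf⟩ := Submodule.smithNormalForm b N
  have hfi : ∀ i : Fin n, φ (snf.bM (snf.f i)) = 0 := by
    intro i
    have hmem : ((snf.bN i : N) : L) ∈ N := (snf.bN i).2
    rw [hN, snf.snf i, map_zsmul] at hmem
    have hai : snf.a i ≠ 0 := by
      intro h0'
      have h0'' : ((snf.bN i : N) : L) = 0 := by rw [snf.snf i, h0', zero_smul]
      exact snf.bN.ne_zero i (Subtype.ext h0'')
    exact (smul_eq_zero.mp hmem).resolve_left hai
  -- some index is NOT in the range of `f` (else `φ = 0`)
  obtain ⟨i₀, hi₀⟩ : ∃ i₀ : Fin 3, i₀ ∉ Set.range snf.f := by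
    by_contra hall
    push Not at hall
    obtain ⟨x, hx⟩ := h0
    apply hx
    have hrepr : x = ∑ i, snf.bM.repr x i • snf.bM i := (snf.bM.sum_repr x).symm
    rw [hrepr, map_sum]
    refine Finset.sum_eq_zero fun i _ => ?_
    obtain ⟨j, hj⟩ := hall i
    rw [map_zsmul, ← hj, hfi j, smul_zero]
  -- every other index IS in the range of `f` (else two coordinates vanish on `N`, contradicting rank two)
  have hother : ∀ i, i ≠ i₀ → i ∈ Set.range snf.f := by
    intro i hi
    by_contra hi'
    obtain ⟨x, y, hx, hy, hind⟩ := h2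
    have hxN : x ∈ N := (hN x).mpr hx
    have hyN : y ∈ N := (hN y).mpr hy
    -- on `N` the coordinates `i` and `i₀` vanish, so `N` sits in the line spanned by the third basis vector `bM k`
    have hx0 : snf.bM.repr x i = 0 := snf.repr_eq_zero_of_notMem_range ⟨x, hxN⟩ hi'
    have hx1 : snf.bM.repr x i₀ = 0 := snf.repr_eq_zero_of_notMem_range ⟨x, hxN⟩ hi₀
    have hy0 : snf.bM.repr y i = 0 := snf.repr_eq_zero_of_notMem_range ⟨y, hyN⟩ hi'
    have hy1 : snf.bM.repr y i₀ = 0 := snf.repr_eq_zero_of_notMem_range ⟨y, hyN⟩ hi₀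
    obtain ⟨k, hk, hk₀⟩ : ∃ k : Fin 3, k ≠ i ∧ k ≠ i₀ := fin3_third i i₀ hi
    have hcoord : ∀ z : L, snf.bM.repr z i = 0 → snf.bM.repr z i₀ = 0 → z = snf.bM.repr z k • snf.bM k := by
      intro z hz hz₀
      have hrepr : z = ∑ j, snf.bM.repr z j • snf.bM j := (snf.bM.sum_repr z).symm
      conv_lhs => rw [hrepr]
      rw [Fin.sum_univ_three]
      have hcases : ∀ j : Fin 3, j = i ∨ j = i₀ ∨ j = k := fin3_cases i i₀ k hi hk hk₀
      -- kill the two vanishing coordinates, keep `k`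
      have hjz : ∀ j : Fin 3, j ≠ k → snf.bM.repr z j • snf.bM j = 0 := by
        intro j hjk
        rcases hcases j with rfl | rfl | rfl
        · rw [hz, zero_smul]
        · rw [hz₀, zero_smul]
        · exact absurd rfl hjk
      fin_cases k
      · rw [hjz 1 (by decide), hjz 2 (by decide)]; simp
      · rw [hjz 0 (by decide), hjz 2 (by decide)]; simp
      · rw [hjz 0 (by decide), hjz 1 (by decide)]; simp
    obtain ⟨cx, hx'⟩ : ∃ c : ℤ, x = c • snf.bM k := ⟨_, hcoord x hx0 hx1⟩
    obtain ⟨cy, hy'⟩ : ∃ c : ℤ, y = c • snf.bM k := ⟨_, hcoord y hy0 hy1⟩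
    -- dependence: `cy • x - cx • y = 0`
    have hrel : cy • x + (-cx) • y = 0 := by
      rw [hx', hy', smul_smul, smul_smul, ← add_smul]
      have : cy * cx + -cx * cy = 0 := by ring
      rw [this, zero_smul]
    obtain ⟨-, ht⟩ := hind _ _ hrel
    have hxk : cx = 0 := by simpa using ht
    have hx0' : x = 0 := by rw [hx', hxk, zero_smul]
    have := hind 1 0 (by rw [hx0', smul_zero, zero_smul, add_zero])
    exact one_ne_zero this.1
  refine ⟨snf.bM, i₀, ?_, ?_, ?_⟩
  · -- `φ (bM i₀) ≠ 0`: else `φ = 0`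
    intro hφ0
    obtain ⟨x, hx⟩ := h0
    apply hx
    have hrepr : x = ∑ i, snf.bM.repr x i • snf.bM i := (snf.bM.sum_repr x).symm
    rw [hrepr, map_sum]
    refine Finset.sum_eq_zero fun i _ => ?_
    rw [map_zsmul]
    by_cases hi : i = i₀
    · rw [hi, hφ0, smul_zero]
    · obtain ⟨j, hj⟩ := hother i hi
      rw [← hj, hfi j, smul_zero]
  · intro i hi
    obtain ⟨j, hj⟩ := hother i hi
    rw [← hj]; exact hfi j
  · intro f
    have hrepr : f = ∑ i, snf.bM.repr f i • snf.bM i := (snf.bM.sum_repr f).symm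
    conv_lhs => rw [hrepr]
    rw [map_sum, Finset.sum_eq_single i₀]
    · rw [map_zsmul]
    · intro i _ hi
      obtain ⟨j, hj⟩ := hother i hi
      rw [map_zsmul, ← hj, hfi j, smul_zero]
    · intro h; exact absurd (Finset.mem_univ _) h

/-- With ordered values: after a sign the weight-carrying vector has positive weight, and every `f` of positive weight a positive coordinate. -/
theorem exists_kernel_adapted_basis_of_rank_two_ker_pos {L : Type} [AddCommGroup L] (b : Module.Basis (Fin 3) ℤ L) {W : Type}
    [AddCommGroup W] [LinearOrder W] [IsOrderedAddMonoid W] (φ : L →+ W) (h0 : ∃ x : L, φ x ≠ 0)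
    (h2 : ∃ x y : L, φ x = 0 ∧ φ y = 0 ∧ ∀ s t : ℤ, s • x + t • y = 0 → s = 0 ∧ t = 0) :
    ∃ (e : Module.Basis (Fin 3) ℤ L) (i₀ : Fin 3), 0 < φ (e i₀) ∧ (∀ i, i ≠ i₀ → φ (e i) = 0) ∧
      (∀ f : L, φ f = e.repr f i₀ • φ (e i₀)) ∧ ∀ f : L, 0 < φ f → 0 < e.repr f i₀ := by
  obtain ⟨e, i₀, hne, hker, hcoord⟩ := exists_kernel_adapted_basis_of_rank_two_ker b φ h0 h2
  -- sign
  obtain ⟨ε, hε, hpos⟩ : ∃ ε : ℤˣ, (ε = 1 ∨ ε = -1) ∧ 0 < (ε : ℤ) • φ (e i₀) := by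
    rcases lt_or_gt_of_ne hne with hlt | hgt
    · exact ⟨-1, Or.inr rfl, by simpa using hlt⟩
    · exact ⟨1, Or.inl rfl, by simpa using hgt⟩
  let w : Fin 3 → ℤˣ := fun i => if i = i₀ then ε else 1
  have hw : w i₀ = ε := by simp [w]
  have hεinv : ε⁻¹ = ε := by rcases hε with rfl | rfl <;> rfl
  refine ⟨e.unitsSMul w, i₀, ?_, ?_, ?_, ?_⟩
  · rw [Module.Basis.unitsSMul_apply, hw, Units.smul_def, map_zsmul]; exact hpos
  · intro i hi
    rw [Module.Basis.unitsSMul_apply, Units.smul_def, map_zsmul, hker i hi, smul_zero]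
  · intro f
    rw [Module.Basis.repr_unitsSMul, Module.Basis.unitsSMul_apply, hw, hεinv, Units.smul_def, Units.smul_def, map_zsmul,
      smul_smul, smul_eq_mul]
    have hεε : (ε : ℤ) * ε = 1 := by rcases hε with rfl | rfl <;> rfl
    rw [mul_comm ((ε : ℤ)) (e.repr f i₀), mul_assoc, hεε, mul_one]
    exact hcoord f
  · intro f hf
    have key : φ f = ((e.unitsSMul w).repr f i₀) • ((ε : ℤ) • φ (e i₀)) := by
      rw [Module.Basis.repr_unitsSMul, hw, hεinv, Units.smul_def, smul_smul, smul_eq_mul]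
      have hεε : (ε : ℤ) * ε = 1 := by rcases hε with rfl | rfl <;> rfl
      rw [mul_comm ((ε : ℤ)) (e.repr f i₀), mul_assoc, hεε, mul_one]
      exact hcoord f
    rw [key] at hf
    by_contra hle
    push Not at hle
    have : ((e.unitsSMul w).repr f i₀) • ((ε : ℤ) • φ (e i₀)) ≤ 0 :=
      smul_nonpos_of_nonpos_of_nonneg hle hpos.le
    exact absurd hf (not_lt.mpr this)

/-! ## (rev 6) CLASS (B) TORIC LEMMA — complete lattice form (the dichotomy `ρ = 2` / `ρ = 1` packaged)

Input the port has: a rank-3 exponent lattice `L` (basis `b` = exponents of `s₁,s₂,s₃` or any basis), the monomial valuation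
`φ : L →+ W` into the (archimedean, class (B)) value group, ONE non-trivial integer relation among the weights (from `rr Γ ≤ 2`, i.e. the
transcendence-defect hypothesis (htd) of the stub), and the finite set `F` of exponents of positive value that must become regular monomials.
Output: either (`ρ = 2`) an adapted triple `(m₁, m₂, e 2)` — `e` a basis with `φ(e 2) = 0`, `e 0, e 1 ∈ ℤm₁ + ℤm₂` unimodularly,
`φ(m₁), φ(m₂) > 0`, every `f ∈ F` with explicit coordinates, the `m₁, m₂`-ones positive —, or (`ρ = 1`) a basis `e` and an index `i₀` with
`φ(e i₀) > 0`, `φ(e i) = 0 (i ≠ i₀)`, `φ f = (e.repr f i₀) • φ(e i₀)` and every `f` of positive value having positive `i₀`-coordinate. -/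

theorem toric_lemma_classB {L : Type} [AddCommGroup L] (b : Module.Basis (Fin 3) ℤ L) {W : Type} [AddCommGroup W] [LinearOrder W]
    [IsOrderedAddMonoid W] [Archimedean W] (φ : L →+ W) (hrel : ∃ x : L, x ≠ 0 ∧ φ x = 0) (hne : ∃ x : L, φ x ≠ 0)
    (F : Finset L) (hF : ∀ f ∈ F, 0 < φ f) :
    (∃ (e : Module.Basis (Fin 3) ℤ L) (m₁ m₂ : L) (a b' c d : ℤ), φ (e 2) = 0 ∧ (a * d - b' * c = 1 ∨ a * d - b' * c = -1) ∧
      e 0 = a • m₁ + b' • m₂ ∧ e 1 = c • m₁ + d • m₂ ∧ 0 < φ m₁ ∧ 0 < φ m₂ ∧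
      (∀ f : L, φ f = 0 → e.repr f 0 = 0 ∧ e.repr f 1 = 0) ∧
      ∀ f ∈ F, f = (e.repr f 0 * a + e.repr f 1 * c) • m₁ + (e.repr f 0 * b' + e.repr f 1 * d) • m₂ + e.repr f 2 • e 2 ∧
        0 < e.repr f 0 * a + e.repr f 1 * c ∧ 0 < e.repr f 0 * b' + e.repr f 1 * d) ∨
    (∃ (e : Module.Basis (Fin 3) ℤ L) (i₀ : Fin 3), 0 < φ (e i₀) ∧ (∀ i, i ≠ i₀ → φ (e i) = 0) ∧
      (∀ f : L, φ f = e.repr f i₀ • φ (e i₀)) ∧ ∀ f : L, 0 < φ f → 0 < e.repr f i₀) := by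
  by_cases h2 : ∀ x y : L, φ x = 0 → φ y = 0 → ∃ s t : ℤ, (s ≠ 0 ∨ t ≠ 0) ∧ s • x + t • y = 0
  · left
    obtain ⟨e, hker, hind⟩ := exists_kernel_adapted_basis b φ hrel h2
    obtain ⟨m₁, m₂, a, b', c, d, hdet, h0, h1, hm₁, hm₂, hcoord⟩ :=
      exists_adapted_basis_rank3_archimedean e φ hker hind F hF
    -- (rev 9) the kernel clause: `ker φ = ℤ · e 2`
    have hkc : ∀ f : L, φ f = 0 → e.repr f 0 = 0 ∧ e.repr f 1 = 0 := by
      intro f hf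
      apply hind
      have hrepr : f = e.repr f 0 • e 0 + e.repr f 1 • e 1 + e.repr f 2 • e 2 := by
        conv_lhs => rw [← e.sum_repr f]
        rw [Fin.sum_univ_three]
      have h := hf
      rw [hrepr, map_add, map_add, map_zsmul, map_zsmul, map_zsmul, hker, smul_zero, add_zero] at h
      exact h
    exact ⟨e, m₁, m₂, a, b', c, d, hker, hdet, h0, h1, hm₁, hm₂, hkc, hcoord⟩
  · right
    push Not at h2
    obtain ⟨x, y, hx, hy, hind⟩ := h2
    refine exists_kernel_adapted_basis_of_rank_two_ker_pos b φ hne ⟨x, y, hx, hy, fun s t hst => ?_⟩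
    by_contra hnot
    rw [not_and_or] at hnot
    rcases hnot with hs | ht
    · exact hind s t (Or.inl hs) hst
    · exact hind s t (Or.inr ht) hst

/-! ## (rev 7) Class (C): the two-level (lexicographic) toric lemma, lattice form

Class (C) = the value group `Γ` has rank two (a proper convex subgroup `Δ`); `rr Γ = 2` by (htd).  On the exponent lattice `L ≅ ℤ³`
the weight is then read through TWO integer functionals supplied by the port: `φ₁` = the class of the value in `Γ/Δ` and `φ₂` = a
`Δ`-coordinate (both identified with `ℤ` on the finitely generated image, a section chosen once); `v`-positivity of a monomial is
LEX-positivity `0 < φ₁ ∨ (φ₁ = 0 ∧ 0 < φ₂)`.  Internally this is the weight `Φ = (φ₁, φ₂) : L →+ ℤ ×ₗ ℤ`, a linearly ordered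
(non-archimedean) group, so `exists_kernel_adapted_basis` and the `ρ = 1` branch apply verbatim; for `ρ = 2` the plane is refined by
`exists_unimodular_lex_refinement`.  Output: either (`ρ = 2`) an adapted basis `(m₁, m₂, e 2)` with `e 2` of weight zero, `m₁` of
positive `φ₁`-weight, `m₂` of weight `(0, b₂)`, `b₂ > 0`, and every `f ∈ F` with non-negative `(m₁, m₂)`-coordinates that are
lex-positive (so some coordinate on a value-positive vector is positive — what §13(b) of the memo uses); or (`ρ = 1`) one basis vector
of positive weight carrying all the weight. -/

/-- **TORIC LEMMA, class (C) (two-level weights), lattice form, complete.** -/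
theorem toric_lemma_classC {L : Type} [AddCommGroup L] (b : Module.Basis (Fin 3) ℤ L) (φ₁ φ₂ : L →+ ℤ)
    (hrel : ∃ x : L, x ≠ 0 ∧ φ₁ x = 0 ∧ φ₂ x = 0) (hne : ∃ x : L, φ₁ x ≠ 0 ∨ φ₂ x ≠ 0)
    (F : Finset L) (hF : ∀ f ∈ F, 0 < φ₁ f ∨ (φ₁ f = 0 ∧ 0 < φ₂ f)) :
    (∃ (e : Module.Basis (Fin 3) ℤ L) (m₁ m₂ : L) (a b' c d : ℤ),
      (φ₁ (e 2) = 0 ∧ φ₂ (e 2) = 0) ∧ (a * d - b' * c = 1 ∨ a * d - b' * c = -1) ∧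
      e 0 = a • m₁ + b' • m₂ ∧ e 1 = c • m₁ + d • m₂ ∧
      0 < φ₁ m₁ ∧ (φ₁ m₂ = 0 ∧ 0 < φ₂ m₂) ∧
      (∀ f : L, φ₁ f = 0 → φ₂ f = 0 → e.repr f 0 = 0 ∧ e.repr f 1 = 0) ∧
      ∀ f ∈ F, f = (e.repr f 0 * a + e.repr f 1 * c) • m₁ + (e.repr f 0 * b' + e.repr f 1 * d) • m₂ + e.repr f 2 • e 2 ∧
        0 ≤ e.repr f 0 * a + e.repr f 1 * c ∧ 0 ≤ e.repr f 0 * b' + e.repr f 1 * d ∧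
        (0 < e.repr f 0 * a + e.repr f 1 * c ∨
          (e.repr f 0 * a + e.repr f 1 * c = 0 ∧ 0 < e.repr f 0 * b' + e.repr f 1 * d))) ∨
    (∃ (e : Module.Basis (Fin 3) ℤ L) (i₀ : Fin 3),
      (0 < φ₁ (e i₀) ∨ (φ₁ (e i₀) = 0 ∧ 0 < φ₂ (e i₀))) ∧ (∀ i, i ≠ i₀ → φ₁ (e i) = 0 ∧ φ₂ (e i) = 0) ∧
      (∀ f : L, φ₁ f = e.repr f i₀ * φ₁ (e i₀) ∧ φ₂ f = e.repr f i₀ * φ₂ (e i₀)) ∧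
      ∀ f : L, (0 < φ₁ f ∨ (φ₁ f = 0 ∧ 0 < φ₂ f)) → 0 < e.repr f i₀) := by
  classical
  -- the lexicographic weight `Φ = (φ₁, φ₂) : L → ℤ ×ₗ ℤ`
  let Φ : L →+ ℤ ×ₗ ℤ :=
    { toFun := fun x => toLex (φ₁ x, φ₂ x)
      map_zero' := by simp only [map_zero]; rfl
      map_add' := fun x y => by simp only [map_add]; rfl }
  have hΦ : ∀ x, Φ x = toLex (φ₁ x, φ₂ x) := fun _ => rfl
  have h0lex : (0 : ℤ ×ₗ ℤ) = toLex ((0 : ℤ), (0 : ℤ)) := rfl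
  have hΦzero : ∀ x, Φ x = 0 ↔ φ₁ x = 0 ∧ φ₂ x = 0 := fun x => by
    rw [hΦ, h0lex, toLex_inj, Prod.mk.injEq]
  have hΦpos : ∀ x, 0 < Φ x ↔ 0 < φ₁ x ∨ (φ₁ x = 0 ∧ 0 < φ₂ x) := fun x => by
    rw [hΦ, h0lex, Prod.Lex.toLex_lt_toLex]
    exact or_congr Iff.rfl (and_congr eq_comm Iff.rfl)
  by_cases h2 : ∀ x y : L, Φ x = 0 → Φ y = 0 → ∃ s t : ℤ, (s ≠ 0 ∨ t ≠ 0) ∧ s • x + t • y = 0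
  · left
    obtain ⟨x₀, hx₀, hx₀1, hx₀2⟩ := hrel
    obtain ⟨e, hker, hind⟩ := exists_kernel_adapted_basis b Φ ⟨x₀, hx₀, (hΦzero x₀).mpr ⟨hx₀1, hx₀2⟩⟩ h2
    have hker' : φ₁ (e 2) = 0 ∧ φ₂ (e 2) = 0 := (hΦzero _).mp hker
    -- coordinates
    have hrepr : ∀ f : L, f = e.repr f 0 • e 0 + e.repr f 1 • e 1 + e.repr f 2 • e 2 := by
      intro f
      conv_lhs => rw [← e.sum_repr f]
      rw [Fin.sum_univ_three]
    have hφ₁ : ∀ f : L, φ₁ f = e.repr f 0 * φ₁ (e 0) + e.repr f 1 * φ₁ (e 1) := by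
      intro f
      conv_lhs => rw [hrepr f]
      rw [map_add, map_add, map_zsmul, map_zsmul, map_zsmul, hker'.1, smul_zero, add_zero, smul_eq_mul, smul_eq_mul]
    have hφ₂ : ∀ f : L, φ₂ f = e.repr f 0 * φ₂ (e 0) + e.repr f 1 * φ₂ (e 1) := by
      intro f
      conv_lhs => rw [hrepr f]
      rw [map_add, map_add, map_zsmul, map_zsmul, map_zsmul, hker'.2, smul_zero, add_zero, smul_eq_mul, smul_eq_mul]
    -- the two weight vectors are independent: non-zero determinant
    have hlin : ∀ u v : ℤ, u • Φ (e 0) + v • Φ (e 1) =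
        toLex (u * φ₁ (e 0) + v * φ₁ (e 1), u * φ₂ (e 0) + v * φ₂ (e 1)) := by
      intro u v
      rw [← map_zsmul Φ, ← map_zsmul Φ, ← map_add Φ, hΦ]
      simp only [map_add, map_zsmul, smul_eq_mul]
    have hdet : φ₁ (e 0) * φ₂ (e 1) - φ₁ (e 1) * φ₂ (e 0) ≠ 0 := by
      intro hdet
      have hq : φ₂ (e 1) = 0 ∧ -φ₂ (e 0) = 0 := by
        apply hind
        rw [hlin, h0lex, toLex_inj, Prod.mk.injEq]
        constructor
        · linear_combination hdet
        · ring
      have hp : φ₁ (e 1) = 0 ∧ -φ₁ (e 0) = 0 := by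
        apply hind
        rw [hlin, h0lex, toLex_inj, Prod.mk.injEq]
        constructor
        · ring
        · linear_combination (-1 : ℤ) * hdet
      have h10 : (1 : ℤ) = 0 ∧ (0 : ℤ) = 0 := by
        apply hind
        rw [hlin, h0lex, toLex_inj, Prod.mk.injEq, neg_eq_zero.mp hp.2, neg_eq_zero.mp hq.2]
        constructor <;> ring
      exact one_ne_zero h10.1
    -- the lexicographic plane refinement
    obtain ⟨a, b', c, d, g, b₁, b₂, hdet1, hg, hb₂, hp₁, hp₂, hq₁, hq₂, hnonneg⟩ :=
      exists_unimodular_lex_refinement (φ₁ (e 0)) (φ₁ (e 1)) (φ₂ (e 0)) (φ₂ (e 1)) hdet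
        (F.image fun f => (e.repr f 0, e.repr f 1))
        (by
          intro g hg
          obtain ⟨f, hf, rfl⟩ := Finset.mem_image.mp hg
          have h := hF f hf
          rw [hφ₁ f, hφ₂ f] at h
          exact h)
    -- the new basis vectors (inverse of the unimodular matrix, sign-corrected)
    obtain ⟨ε, hε, hεdet⟩ : ∃ ε : ℤ, (ε = 1 ∨ ε = -1) ∧ ε * (a * d - b' * c) = 1 := by
      rcases hdet1 with h | h
      · exact ⟨1, Or.inl rfl, by rw [h]; ring⟩
      · exact ⟨-1, Or.inr rfl, by rw [h]; ring⟩
    -- (rev 9) the kernel clause: `ker Φ = ℤ · e 2`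
    have hkc : ∀ f : L, φ₁ f = 0 → φ₂ f = 0 → e.repr f 0 = 0 ∧ e.repr f 1 = 0 := by
      intro f hf1 hf2
      apply hind
      rw [hlin, ← hφ₁ f, ← hφ₂ f, hf1, hf2]
      rfl
    refine ⟨e, ε • (d • e 0 - b' • e 1), ε • (-c • e 0 + a • e 1), a, b', c, d, hker', hdet1, ?_, ?_, ?_, ?_, hkc, ?_⟩
    · have : a • (ε • (d • e 0 - b' • e 1)) + b' • (ε • (-c • e 0 + a • e 1)) = (ε * (a * d - b' * c)) • e 0 := by
        module
      rw [this, hεdet, one_smul]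
    · have : c • (ε • (d • e 0 - b' • e 1)) + d • (ε • (-c • e 0 + a • e 1)) = (ε * (a * d - b' * c)) • e 1 := by
        module
      rw [this, hεdet, one_smul]
    · have : φ₁ (ε • (d • e 0 - b' • e 1)) = (ε * (a * d - b' * c)) * g := by
        rw [map_zsmul, map_sub, map_zsmul, map_zsmul, hp₁, hp₂]
        simp only [smul_eq_mul]
        ring
      rw [this, hεdet, one_mul]
      exact hg
    · constructor
      · have : φ₁ (ε • (-c • e 0 + a • e 1)) = 0 := by
          rw [map_zsmul, map_add, map_zsmul, map_zsmul, hp₁, hp₂]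
          simp only [smul_eq_mul]
          ring
        exact this
      · have : φ₂ (ε • (-c • e 0 + a • e 1)) = (ε * (a * d - b' * c)) * b₂ := by
          rw [map_zsmul, map_add, map_zsmul, map_zsmul, hq₁, hq₂]
          simp only [smul_eq_mul]
          ring
        rw [this, hεdet, one_mul]
        exact hb₂
    · intro f hf
      have hg' := hnonneg (e.repr f 0, e.repr f 1) (Finset.mem_image.mpr ⟨f, hf, rfl⟩)
      have key : (e.repr f 0 * a + e.repr f 1 * c) • (ε • (d • e 0 - b' • e 1)) +
          (e.repr f 0 * b' + e.repr f 1 * d) • (ε • (-c • e 0 + a • e 1)) =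
          (ε * (a * d - b' * c) * e.repr f 0) • e 0 + (ε * (a * d - b' * c) * e.repr f 1) • e 1 := by
        module
      have hdecomp : f = (e.repr f 0 * a + e.repr f 1 * c) • (ε • (d • e 0 - b' • e 1)) +
          (e.repr f 0 * b' + e.repr f 1 * d) • (ε • (-c • e 0 + a • e 1)) + e.repr f 2 • e 2 := by
        rw [key, hεdet, one_mul, one_mul]
        exact hrepr f
      refine ⟨hdecomp, hg'.1, hg'.2, ?_⟩
      have hφ₁f : φ₁ f = (e.repr f 0 * a + e.repr f 1 * c) * g := by
        rw [hφ₁ f, hp₁, hp₂]; ring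
      have hφ₂f : φ₂ f = (e.repr f 0 * a + e.repr f 1 * c) * b₁ + (e.repr f 0 * b' + e.repr f 1 * d) * b₂ := by
        rw [hφ₂ f, hq₁, hq₂]; ring
      rcases hF f hf with h | ⟨h1, h2⟩
      · left
        rw [hφ₁f] at h
        by_contra hC
        have hC0 : e.repr f 0 * a + e.repr f 1 * c = 0 := le_antisymm (not_lt.mp hC) hg'.1
        rw [hC0, zero_mul] at h
        exact lt_irrefl _ h
      · right
        have hC₁ : e.repr f 0 * a + e.repr f 1 * c = 0 := by
          rw [hφ₁f] at h1
          rcases mul_eq_zero.mp h1 with h | h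
          · exact h
          · exact absurd h hg.ne'
        refine ⟨hC₁, ?_⟩
        rw [hφ₂f, hC₁, zero_mul, zero_add] at h2
        by_contra hC
        have hC0 : e.repr f 0 * b' + e.repr f 1 * d = 0 := le_antisymm (not_lt.mp hC) hg'.2
        rw [hC0, zero_mul] at h2
        exact lt_irrefl _ h2
  · right
    push Not at h2
    obtain ⟨x, y, hx, hy, hind⟩ := h2
    have hind' : ∀ s t : ℤ, s • x + t • y = 0 → s = 0 ∧ t = 0 := by
      intro s t hst
      by_contra hnot
      rw [not_and_or] at hnot
      rcases hnot with hs | ht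
      · exact hind s t (Or.inl hs) hst
      · exact hind s t (Or.inr ht) hst
    obtain ⟨x₁, hx₁⟩ := hne
    have h0 : ∃ x : L, Φ x ≠ 0 := by
      refine ⟨x₁, fun h => ?_⟩
      rcases hx₁ with h' | h'
      · exact h' ((hΦzero x₁).mp h).1
      · exact h' ((hΦzero x₁).mp h).2
    obtain ⟨e, i₀, hpos, hker, hrepr, hposf⟩ :=
      exists_kernel_adapted_basis_of_rank_two_ker_pos b Φ h0 ⟨x, y, hx, hy, hind'⟩
    refine ⟨e, i₀, (hΦpos _).mp hpos, fun i hi => (hΦzero _).mp (hker i hi), fun f => ?_,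
      fun f hf => hposf f ((hΦpos f).mpr hf)⟩
    have h := hrepr f
    rw [← map_zsmul Φ, hΦ, hΦ, toLex_inj, Prod.mk.injEq, map_zsmul, map_zsmul, smul_eq_mul, smul_eq_mul] at h
    exact h

/-! ## (rev 8) The TWO-LEVEL READING of a rank-two weight — the input `φ₁, φ₂` of `toric_lemma_classC`

The port has, in class (C): the monomial weight `φ : L →+ W` (`W` = the value group of `v`, written additively), the coarsening
`ψ : W →+ W₁` to the value group of the rank-one coarsening `v₁` (Mathlib `ValuationSubring.mapOfLE`, monotone), and from (htd)
`rr Γ ≤ 2`: both `W₁ = Γ/Δ` and `Δ = ker ψ` have rational rank `≤ 1` (any two elements are `ℤ`-dependent); finally some parameter has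
value outside `Δ` (else `v(M^×) ⊆ Δ`, impossible for a rank-two group of finite index).  From exactly these data the theorem produces
`φ₁, φ₂ : L →+ ℤ` with `0 < φ f ⟺ 0 < φ₁ f ∨ (φ₁ f = 0 ∧ 0 < φ₂ f)` and `φ f = 0 ⟺ φ₁ f = φ₂ f = 0` for ALL `f ∈ L` — so the hypotheses
and the conclusions of `toric_lemma_classC` translate to and from `v`-values of monomials.  Proof: the coarse weight `ψ ∘ φ` has a kernel
of rank two, so (`exists_kernel_adapted_basis_of_rank_two_ker_pos`) one basis vector `e_{i₁}` carries it: `φ₁ :=` its coordinate; the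
remainder `φ' := φ − φ₁ • φ(e_{i₁})` takes values in `Δ`, and either vanishes (`φ₂ := 0`) or again has a rank-two kernel, whence `φ₂`. -/

lemma fin3_other (i₀ : Fin 3) : ∃ j : Fin 3, j ≠ i₀ := by
  revert i₀; decide

/-- **THE TWO-LEVEL READING** (class (C)): integer functionals `φ₁, φ₂` reading `v`-positivity of monomials lexicographically. -/
theorem exists_two_level_reading {L : Type} [AddCommGroup L] (b : Module.Basis (Fin 3) ℤ L)
    {W W₁ : Type} [AddCommGroup W] [LinearOrder W] [IsOrderedAddMonoid W]
    [AddCommGroup W₁] [LinearOrder W₁] [IsOrderedAddMonoid W₁]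
    (φ : L →+ W) (ψ : W →+ W₁) (hψ : Monotone ψ)
    (hW₁ : ∀ w w' : W₁, ∃ s t : ℤ, (s ≠ 0 ∨ t ≠ 0) ∧ s • w + t • w' = 0)
    (hΔ : ∀ w w' : W, ψ w = 0 → ψ w' = 0 → ∃ s t : ℤ, (s ≠ 0 ∨ t ≠ 0) ∧ s • w + t • w' = 0)
    (hne : ∃ x : L, ψ (φ x) ≠ 0) :
    ∃ φ₁ φ₂ : L →+ ℤ, ∀ f : L,
      (0 < φ f ↔ 0 < φ₁ f ∨ (φ₁ f = 0 ∧ 0 < φ₂ f)) ∧ (φ f = 0 ↔ φ₁ f = 0 ∧ φ₂ f = 0) := by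
  classical
  -- the coarse weight
  let χ : L →+ W₁ := ψ.comp φ
  have hχ : ∀ x, χ x = ψ (φ x) := fun _ => rfl
  -- Step 1: a basis vector of non-zero coarse weight, and two independent vectors of coarse weight zero
  obtain ⟨i₀, hi₀⟩ : ∃ i₀ : Fin 3, χ (b i₀) ≠ 0 := by
    by_contra hall
    push Not at hall
    obtain ⟨x, hx⟩ := hne
    apply hx
    rw [← hχ, ← b.sum_repr x, map_sum]
    exact Finset.sum_eq_zero fun i _ => by rw [map_zsmul, hall i, smul_zero]
  obtain ⟨j, hj⟩ := fin3_other i₀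
  obtain ⟨k, hkj, hk⟩ := fin3_third j i₀ hj
  have hkv : ∀ i : Fin 3, ∃ s t : ℤ, s ≠ 0 ∧ χ (s • b i + t • b i₀) = 0 := by
    intro i
    obtain ⟨s, t, hst, h⟩ := hW₁ (χ (b i)) (χ (b i₀))
    by_cases hs : s = 0
    · subst hs
      rw [zero_smul, zero_add] at h
      rcases hst with h0 | h0
      · exact absurd rfl h0
      · exact absurd ((smul_eq_zero.mp h).resolve_left h0) hi₀
    · exact ⟨s, t, hs, by rw [map_add, map_zsmul, map_zsmul]; exact h⟩
  obtain ⟨s₁, t₁, hs₁, hx⟩ := hkv j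
  obtain ⟨s₂, t₂, hs₂, hy⟩ := hkv k
  have hind : ∀ s t : ℤ, s • (s₁ • b j + t₁ • b i₀) + t • (s₂ • b k + t₂ • b i₀) = 0 → s = 0 ∧ t = 0 := by
    intro s t hst
    have hcj := congrArg (fun z => b.repr z j) hst
    have hck := congrArg (fun z => b.repr z k) hst
    simp only [map_add, map_zsmul, map_zero, Finsupp.coe_add, Finsupp.coe_smul, Pi.add_apply, Pi.smul_apply,
      Module.Basis.repr_self, Finsupp.single_apply, Finsupp.coe_zero, Pi.zero_apply, smul_eq_mul,
      Ne.symm hj, hkj, Ne.symm hk, Ne.symm hkj, if_true, if_false] at hcj hck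
    constructor
    · have h1 : s * s₁ = 0 := by rw [← hcj]; ring
      exact (mul_eq_zero.mp h1).resolve_right hs₁
    · have h1 : t * s₂ = 0 := by rw [← hck]; ring
      exact (mul_eq_zero.mp h1).resolve_right hs₂
  -- Step 2: the coarse weight is carried by one basis vector `e i₁`; `φ₁ :=` its coordinate
  obtain ⟨e, i₁, hpos₁, -, hrepr₁, -⟩ :=
    exists_kernel_adapted_basis_of_rank_two_ker_pos b χ ⟨b i₀, hi₀⟩
      ⟨s₁ • b j + t₁ • b i₀, s₂ • b k + t₂ • b i₀, hx, hy, hind⟩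
  let φ₁ : L →+ ℤ :=
    { toFun := fun f => e.repr f i₁
      map_zero' := by simp
      map_add' := fun f g => by simp }
  have hφ₁ : ∀ f, φ₁ f = e.repr f i₁ := fun _ => rfl
  have hw₁ψ : 0 < ψ (φ (e i₁)) := by simpa only [hχ] using hpos₁
  have hw₁ : 0 < φ (e i₁) := by
    by_contra hle
    push Not at hle
    have h := hψ hle
    rw [map_zero] at h
    exact absurd hw₁ψ (not_lt.mpr h)
  -- Step 3: the fine part `φ' := φ - φ₁ • φ (e i₁)` takes values in `ker ψ`
  let φ' : L →+ W :=
    { toFun := fun f => φ f - e.repr f i₁ • φ (e i₁)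
      map_zero' := by simp
      map_add' := fun f g => by
        simp only [map_add, Finsupp.coe_add, Pi.add_apply, add_smul]
        abel }
  have hφ' : ∀ f, φ' f = φ f - e.repr f i₁ • φ (e i₁) := fun _ => rfl
  have hφ'ψ : ∀ f, ψ (φ' f) = 0 := by
    intro f
    rw [hφ', map_sub, map_zsmul]
    have h := hrepr₁ f
    simp only [hχ] at h
    rw [h, sub_self]
  have hdecomp : ∀ f, φ f = e.repr f i₁ • φ (e i₁) + φ' f := fun f => by rw [hφ']; abel
  have hφ'e : φ' (e i₁) = 0 := by
    rw [hφ', Module.Basis.repr_self, Finsupp.single_eq_same, one_smul, sub_self]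
  by_cases hzero : ∀ i, φ' (e i) = 0
  · -- one level only: `φ = φ₁ • w₁`
    have hφ'0 : ∀ f, φ' f = 0 := by
      intro f
      rw [← e.sum_repr f, map_sum]
      exact Finset.sum_eq_zero fun i _ => by rw [map_zsmul, hzero i, smul_zero]
    refine ⟨φ₁, 0, fun f => ⟨?_, ?_⟩⟩
    · rw [hdecomp f, hφ'0 f, add_zero, AddMonoidHom.zero_apply, hφ₁]
      constructor
      · intro h
        left
        by_contra hle
        push Not at hle
        exact absurd h (not_lt.mpr (smul_nonpos_of_nonpos_of_nonneg hle hw₁.le))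
      · rintro (h | ⟨_, h⟩)
        · exact smul_pos h hw₁
        · exact absurd h (lt_irrefl _)
    · rw [hdecomp f, hφ'0 f, add_zero, AddMonoidHom.zero_apply, hφ₁]
      constructor
      · intro h
        exact ⟨(smul_eq_zero.mp h).resolve_right hw₁.ne', rfl⟩
      · rintro ⟨h, -⟩
        rw [h, zero_smul]
  · -- second level: `φ'` is carried by one vector of a further adapted basis
    push Not at hzero
    obtain ⟨i₂, hi₂⟩ := hzero
    obtain ⟨j', hj'⟩ := fin3_other i₁
    obtain ⟨k', hk'j', hk'⟩ := fin3_third j' i₁ hj'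
    obtain ⟨s, t, hst, hrel⟩ := hΔ (φ' (e j')) (φ' (e k')) (hφ'ψ (e j')) (hφ'ψ (e k'))
    have hyk : φ' (s • e j' + t • e k') = 0 := by rw [map_add, map_zsmul, map_zsmul]; exact hrel
    have hind' : ∀ σ τ : ℤ, σ • e i₁ + τ • (s • e j' + t • e k') = 0 → σ = 0 ∧ τ = 0 := by
      intro σ τ h
      have hc1 := congrArg (fun z => e.repr z i₁) h
      have hcj := congrArg (fun z => e.repr z j') h
      have hck := congrArg (fun z => e.repr z k') h
      simp only [map_add, map_zsmul, map_zero, Finsupp.coe_add, Finsupp.coe_smul, Pi.add_apply, Pi.smul_apply,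
        Module.Basis.repr_self, Finsupp.single_apply, Finsupp.coe_zero, Pi.zero_apply, smul_eq_mul,
        Ne.symm hj', hk', Ne.symm hk', hj', hk'j', Ne.symm hk'j', if_true, if_false] at hc1 hcj hck
      have hσ : σ = 0 := by rw [← hc1]; ring
      have hτs : τ * s = 0 := by rw [← hcj]; ring
      have hτt : τ * t = 0 := by rw [← hck]; ring
      refine ⟨hσ, ?_⟩
      rcases hst with hs | ht
      · exact (mul_eq_zero.mp hτs).resolve_right hs
      · exact (mul_eq_zero.mp hτt).resolve_right ht
    obtain ⟨e', i₃, hpos₂, -, hrepr₂, -⟩ :=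
      exists_kernel_adapted_basis_of_rank_two_ker_pos b φ' ⟨e i₂, hi₂⟩
        ⟨e i₁, s • e j' + t • e k', hφ'e, hyk, hind'⟩
    let φ₂ : L →+ ℤ :=
      { toFun := fun f => e'.repr f i₃
        map_zero' := by simp
        map_add' := fun f g => by simp }
    have hφ₂ : ∀ f, φ₂ f = e'.repr f i₃ := fun _ => rfl
    have hw₂ : 0 < φ' (e' i₃) := hpos₂
    have hw₂ψ : ψ (φ' (e' i₃)) = 0 := hφ'ψ _
    have hf : ∀ f, φ f = e.repr f i₁ • φ (e i₁) + e'.repr f i₃ • φ' (e' i₃) := fun f => by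
      rw [hdecomp f, hrepr₂ f]
    have hψf : ∀ f, ψ (φ f) = e.repr f i₁ • ψ (φ (e i₁)) := fun f => by
      rw [hf f, map_add, map_zsmul, map_zsmul, hw₂ψ, smul_zero, add_zero]
    refine ⟨φ₁, φ₂, fun f => ⟨?_, ?_⟩⟩
    · rw [hφ₁, hφ₂]
      constructor
      · intro hpos
        have h0 : 0 ≤ ψ (φ f) := by simpa using hψ hpos.le
        rw [hψf f] at h0
        have hn : 0 ≤ e.repr f i₁ := by
          by_contra hlt
          push Not at hlt
          exact absurd h0 (not_le.mpr (smul_neg_of_neg_of_pos hlt hw₁ψ))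
        rcases hn.lt_or_eq with hn | hn
        · exact Or.inl hn
        · right
          refine ⟨hn.symm, ?_⟩
          rw [hf f, ← hn, zero_smul, zero_add] at hpos
          by_contra hle
          push Not at hle
          exact absurd hpos (not_lt.mpr (smul_nonpos_of_nonpos_of_nonneg hle hw₂.le))
      · rintro (hn | ⟨hn, hm⟩)
        · by_contra hle
          push Not at hle
          have h1 : ψ (φ f) ≤ 0 := by simpa using hψ hle
          rw [hψf f] at h1
          exact absurd (smul_pos hn hw₁ψ) (not_lt.mpr h1)
        · rw [hf f, hn, zero_smul, zero_add]
          exact smul_pos hm hw₂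
    · rw [hφ₁, hφ₂]
      constructor
      · intro h0
        have h1 : ψ (φ f) = 0 := by rw [h0, map_zero]
        rw [hψf f] at h1
        have hn : e.repr f i₁ = 0 := (smul_eq_zero.mp h1).resolve_right hw₁ψ.ne'
        refine ⟨hn, ?_⟩
        rw [hf f, hn, zero_smul, zero_add] at h0
        exact (smul_eq_zero.mp h0).resolve_right hw₂.ne'
      · rintro ⟨hn, hm⟩
        rw [hf f, hn, hm, zero_smul, zero_smul, add_zero]

end Summit.ResolutionOfSingularities.ResolutionOfSingularities.Cruxes.DescentPerfectToAll.CpSibling.UnimodularRefinement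

end
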